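import Summits.BirchSwinnertonDyer.BirchSwinnertonDyer.Theses.InertBadSignedBranches
import Summits.BirchSwinnertonDyer.BirchSwinnertonDyer.Theses.BiquadraticEisensteinDescent
import Summits.BirchSwinnertonDyer.BirchSwinnertonDyer.Theorems.InertBadSignedBranchesInertBadAtThreeBedLinks
import Summits.BirchSwinnertonDyer.BirchSwinnertonDyer.Theorems.InertBadSignedBranchesInertBadAtThreeBedGlue
import Summits.BirchSwinnertonDyer.BirchSwinnertonDyer.Theorems.InertBadSignedBranchesInertBadAtThreeNonNullOddHeegner
import Summits.BirchSwinnertonDyer.BirchSwinnertonDyer.Theorems.InertBadSignedBranchesInertBadAtThreeBedManinIstar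
import Summits.BirchSwinnertonDyer.BirchSwinnertonDyer.Theorems.InertBadSignedBranchesInertBadAtThreeManinCells
import Summits.BirchSwinnertonDyer.BirchSwinnertonDyer.Theorems.InertBadSignedBranchesInertBadAtThreeManinOfKatoThree
import Summits.BirchSwinnertonDyer.BirchSwinnertonDyer.Theorems.InertBadSignedBranchesInertBadAtThreePointwiseKatoLever
import Summits.BirchSwinnertonDyer.BirchSwinnertonDyer.Theorems.InertBadSignedBranchesInertBadAtThreeOddPrimeInstances
import Summits.BirchSwinnertonDyer.BirchSwinnertonDyer.Theorems.InertBadSignedBranchesInertBadAtThreeQuarticStub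
import Summits.BirchSwinnertonDyer.BirchSwinnertonDyer.Theorems.InertBadSignedBranchesInertBadAtThreeHeartOfHeartFlat
import Summits.BirchSwinnertonDyer.BirchSwinnertonDyer.Theorems.InertBadSignedBranchesInertBadAtThreeHeartFlatOfParts
import Summits.BirchSwinnertonDyer.BirchSwinnertonDyer.Theorems.InertBadSignedBranchesInertBadAtThreeHeartStubV2
import Summits.BirchSwinnertonDyer.BirchSwinnertonDyer.Theorems.InertBadSignedBranchesInertBadAtThreeBedGlueMin
import Literature.NumberTheory.EllipticCurves.ComplexMultiplicationHasCMProofs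
import Summits.BirchSwinnertonDyer.Rank1Residual.X12.InertBadThreeInstancesA
import Literature.NumberTheory.EllipticCurves.KatoAdditiveTwistedValueNeronIntegralityThree
import Literature.NumberTheory.EllipticCurves.GaussianLatticeHeckeLValue
import Literature.NumberTheory.QuadraticFields.ThreeTorsionMeanHeegner
import HarnessLib

/-!
# Skeleton `rubin_e1_inert_three` v5 — THE LINE OF RECORD for crux `InertBadAtThree` (stmt-BirchSwinnertonDyer-19225), REGISTERED by the lead
# `bsd-line-ibd-p1` g6 (2026-08-28): line `bed_at_three` v5 with Kato's GLOBAL `p = 3` statement (F-es-18, `stub_katoFactThreePolar`, XL named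
# Literature statement) replaced by its POINTWISE instances on the quartic cell `j = 1728`, to be proved on the CM side (ideator
# bsd-idea-18 g6/g7, lens = transfer: idea card `Cruxes/InertBadAtThree/Ideas/rubin-e1-inert-three.md`; proof scheme with every sign fixed:
# `Cruxes/InertBadAtThree/EPSILON-RESOLVED-bsd-idea-18-g7.md`; file v1–v3 published W-79 by the ideator, sha16 v3 = 53088f48ce9ca768).

v8 (lead g9, 2026-08-28T14:xxZ): THE EXACT PRINT LEDGER AT p = 3. The HELD stub is now `stub_printedInputsAtThreeMin : PrintedInputsAtThreeMin` —
the conjunction of EXACTLY the twenty named print facts the `p = 3` composition consumes (each USED by the kernel, none a tree theorem, none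
duplicated; list in the def's docstring), assembled through the lead's helper `…InertBadAtThreeBedGlueMin` (p638913: BED's glue at `p = 3`
re-run with the print hypotheses SPLIT — the kernel shows Edixhoven's Manin theorem and Deuring's supersingular criterion are IDLE on this
line at `p = 3`, and `hasEntireLFunction_rat` is DERIVED from modularity). The two print facts behind V2@3 (Katz's measure = Hsieh 2014
Prop. 4.9, `hsieh2014mu_prop49_exists_isMeasure`; Deuring's Grössencharacter, `Deuring_exists_heckeCharacter_of_maximalCM`) are conjuncts
19–20, so `stub_tiedKatzFrameAtThree` (V2@3) is NO LONGER A STUB: it is the theorem `tiedKatzFrameAtThree_of_printedInputs` (the lead's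
p637355 `…HeartStubV2.stub_tiedKatzFrameAtThree_of_katz_of_deuring`). STUBS v8 (2 sorries): `stub_printedInputsAtThreeMin` (HELD print,
itemised) and `stub_katzLineDivisibilityAtThree` (V4K@3, research — THE ONE research input; = `KatzLineDivisibilityOdd` at `p = 3`).
Dominance kernel-checked: `printedInputsAtThreeMin_of` (v7's held `PrintedInputsAtThreeCM` ∧ Katz ∧ Deuring ⟹ the v8 held stub), so v8's
held content is WEAKER than v7's held content plus V2's print. Composition `InertBadAtThree_bed_of_min : PrintedInputsAtThreeMin →
PlainOddNeronIntegralThreeQuartic → KatzLineDivisibilityAtThree → BiquadraticEisensteinDescent.InertBadAtThree` (BED's verbatim copy of the decl)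
and `InertBadAtThree_proof : InertBadSignedBranches.InertBadAtThree` from the two stubs (the file's ONLY theorem concluding the registered decl, as
the skeleton audit requires); the v7 composition through `PrintedInputsAtThreeCM` is kept for the record on BED's copy (sorry-free, hypotheses in front). Nothing here proves BSD, the crux, or V4K.

v7 (lead g8, 2026-08-28T13:xxZ): THE HEART IS CUT. `stub_heartAtThree` (E_K′@3 = BED's crux `EisensteinDivisibilityCMInertBadFlatAtOneKPrime` at
`p = 3`) is NO LONGER A STUB: it is proved below (§ «v7: the heart cut along BED's `hsieh_lambda` at p = 3») from the HELD print (Hsieh Thm A / Thm B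
= conjuncts `HsiehAnyLevelInput` / `HsiehMuInvariantInput` of `PrintedInputsAtThree`) and TWO NEW REGISTERED STUBS, the `p = 3` twins (texts
VERBATIM, `5 ≤ p` ↦ `p = 3`) of the registered stubs of BED's crux 21341 line `hsieh_lambda` v3: `stub_tiedKatzFrameAtThree` (V2@3: a tied Katz
line frame EXISTS — print by name + typing; at `p ≥ 5` conditionally closed by p625968 modulo `hsieh2014mu_prop49_exists_isMeasure` + Deuring,
whose proof uses only `p ≠ 2` / `2 < p`) and `stub_katzLineDivisibilityAtThree` (V4K@3 = THE INPUT: `∃ m, 3^m · Ch_{𝒪⟦T⟧}(N) · 𝓞_ℂ₃⟦T⟧ ⊆ (G)` for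
the `ψ_L`-branch module against the Katz line series — Hsieh JAMS 27 (2014) Thm 8.14's object on the `K′`-line at `p = 3`, μ-blind; research,
NOT IN PRINT, carries rider R1: JAMS L.7.15 / P.7.16 use `p > 3`). The cut is kernel-checked through four landed helpers of this seat, all
`p ≠ 2`-generic re-runs of the 21341 programme: p635155 `…HeartAbsIrr` ((Irr) for `p ≠ 2`), p635498 `…HeartSqrtEndomorphism` (`[√d_CM]` datum for
`p ≠ 2`), p635870 `…HeartOfHeartFlat` (E_K′@3 ⟸ (B) + ♭-heart@3), p636175 `…HeartFlatOfParts` (♭-heart@3 ⟸ Thm A ∧ V2@3 ∧ V4K@3). STUBS v7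
(3 sorries): `stub_tiedKatzFrameAtThree` (cond. closed p637355), `stub_katzLineDivisibilityAtThree`, `stub_printedInputsAtThreeCM`. v7.1: + `KatzLineDivisibilityOdd`
(V4K for every odd `p`) with the kernel-exact specialisations to this line's V4K@3 and to BED's registered `stub_V4K` text — ONE promotable statement. Consequence: crux 19225 (p = 3) and
BED's crux 21341 (p ≥ 5) hinge on ONE displayed research statement family (V4K, p ≥ 3). Nothing here proves BSD, the crux, or V4K.

v6 (lead g7, 2026-08-28T12:2xZ): `stub_plainOddNeronIntegralThreeQuartic` is NO LONGER A STUB — it is the tree theorem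
`InertBadSignedBranchesInertBadAtThreeQuarticStub.stub_plainOddNeronIntegralThreeQuartic` (p632832, gate: «landed»), the end of the STUB-PLAN wave
(ideator bsd-idea-18 g8/g9; width seats bsd-wall-cm-bed-w1 g7 · w2 g8/g9 · w3 g8 · w4 g9; lead g6/g7): Ireland–Rosen 18.7 theta dictionary for
`y² = x³ + Ax` → finite Eisenstein–Kronecker formula on `ℤi + ℤ` → CRT into `χ₄^k`-twisted `3`-torsion sums of `E₁*` → closed forms + torsion
integrality → model periods → `f`-free odd Néron `3`-integrality → value exit. STUBS v6 (2 sorries): `stub_heartAtThree` (research, W-19) and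
`stub_printedInputsAtThreeCM` (HELD print). Nothing else changed (v5 text below kept verbatim for the record).

v5 (lead g6, same session; registered sha16 see PICKED.md): the quartic stub is WEAKENED AGAIN to what the lever consumes — `stub_plainOddNeronIntegralThreeQuartic`: for a
globally minimal `V` with `j = 1728` bad at `3`, its newform `f` AT CONDUCTOR LEVEL, every PRIME `ℓ ∤ N_V` with `ℓ ≡ 11 (mod 12)`, every ODD `χ`
mod `ℓ` with `χ(3) ≠ 1`, and `ϖ, r` with `ϖ·Ω⁻(V) = Ω⁻_f`, `Σ_a χ(a){∞,a/ℓ}_f = r·Ω⁻_f·i`: `s·ϖ·r ∈ ℤ̄` for some `3 ∤ s` (no even characters,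
no composite moduli, no other levels, NO Euler factors — a CM curve has no `ℓ ∥ N`, helper p626343
`…InertBadAtThreeOddPrimeInstances.symmEuler_eq_one_of_hasCM`). Dominance kernel-checked below: F-es-18 ⟹ C⁺_quartic (v4 stub) ⟹ plain-odd
(v5 stub) (`plainOddQuartic_of_neronIntegralThreeQuartic`); the composition runs through p626343's datum-level lever
`not_three_dvd_c_of_plainOddInstances_of_hasCM`. Stubs v5: `stub_heartAtThree` / `stub_printedInputsAtThreeCM` / `stub_plainOddNeronIntegralThreeQuartic`.

v4 (lead g6): ADOPTED as the skeleton of record (PICKED.md: rubin_e1_inert_three > bed_at_three > k8_split). Lead's changes to v3: (i) the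
registered stub `stub_neronIntegralThreeQuartic` is stated INLINE (tree constants only — the body of `NeronIntegralThreeQuartic` /
`NeronIntegralThreePolarAt` expanded), so that a `Theorems/` closer can state the identical signature without importing this file; the defs
stay for the compositions (definitionally equal); (ii) header and stub docstrings; nothing else. Why adopted over the lead's own draft
`bed_at_three` v6 (stub `NeronIntegralThreeCMInert` = F-es-18's instances on the whole CM-inert-at-3 bad class, published as
`Lines/bed_at_three.lean` v6, fallback): the quartic-cell stub is WEAKER (`neronIntegralThreeQuartic_of_neronIntegralCMInert` below, kernel-checked)
and is the one cell where the CM-side engine is typed in the tree (`GaussianLattice.thetaLFunction_one_eq_sum_kroneckerE₁`, `ℚ(i)`); its price —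
the three PRINTED Manin facts + modularity reinstated in the HELD conjunction for the `Iₙ*` cell — is print, not research. Both v6 shapes are
strictly weaker than v5's F-es-18 stub and are closed by one `_holds` of F-es-18. Nothing here proves BSD, the crux, or any stub.

STUBS (v5: 3 sorries, all inside `stub_*`; v6: 2 — the quartic one is proved):
* `stub_heartAtThree` — VERBATIM v5 (E_K′@3, the research content; BLOCKED-LIKE-BED-HEART, W-19 + rider R1). Unchanged.
* `stub_printedInputsAtThreeCM` — HELD print: v5's `PrintedInputsAtThree` ∧ the three printed Manin facts of BED's R₅₇ split
  (`MazurManinOdd`, `AbbesUllmoManinGood`, `CesnaviciusManinTwo`, conjuncts of v2–v4, dropped in v5 because Kato's statement made them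
  redundant) ∧ modularity `exists_isNewformOf`. They are REINSTATED because this line takes only the quartic III/III* cell from a
  `3`-adic `L`-value statement and the `Iₙ*` cell from print (bed-w2 g7's `maninAtThree_of_facts_of_quarticResidual`, p617415).
* `stub_neronIntegralThreeQuartic` (C⁺_quartic, size XL as a FORMALISATION, no open mathematics): F-es-18's conclusion for THE curve
  `V`, `j(V) = 1728`, bad at `3` (the quartic twists `y² = x³ − Dx`, `3 ∣ D`), via IR 18.5 + the tree's PROVED finite
  Eisenstein–Kronecker formula `GaussianLattice.thetaLFunction_one_eq_sum_kroneckerE₁` + de Shalit-style smoothing + the μ₈-resolvent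
  count on the Lubin–Tate group of `y² = x³ − x` at the inert `3` (memo EPSILON-RESOLVED §§2–8: inputs F1–F5 with tree status).
NOT A STUB ANY MORE: S1 `PointwiseKatoShiftLever` (the g6 card's support) is the THEOREM `pointwiseKatoShiftLever` below, by the lead's
landed helper p624535 `InertBadSignedBranchesInertBadAtThreePointwiseKatoLever.not_three_dvd_c_of_neronIntegralAt` (unconditional).
DOMINANCE: the new stub FOLLOWS from v5's `stub_katoFactThreePolar` (`neronIntegralThreeQuartic_of_katoFact` below, no sorry) and from the
lead's announced v6 stub shape `NeronIntegralThreeCMInert` (`neronIntegralThreeQuartic_of_neronIntegralCMInert`, no sorry), so any closure of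
v5 or v6 closes this line; the converse replaces an XL named statement (derived reading of Kato 2004 + Kosters–Pannekoek, not verbatim
print) by C⁺_quartic (a classical CM computation) plus genuinely printed Manin facts.
Composition (v4–v7; v8 keeps it on BED's copy as `InertBadAtThree_bed_of`) `PrintedInputsAtThreeCM → NeronIntegralThreeQuartic → HeartAtThree → InertBadAtThree`
(kernel-checked, no sorry outside `stub_*`); `InertBadAtThree_bed_of` concludes BED's copy.
-/

set_option linter.dupNamespace false
set_option autoImplicit false

noncomputable section

open scoped MatrixGroups ModularForm Classical

open CongruenceSubgroup WeierstrassCurve Literature.NumberTheory.EllipticCurves Literature.NumberTheory.EllipticCurves.Rank1Residual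
  Literature.NumberTheory.EllipticCurves.ModularForms

namespace Summit.BirchSwinnertonDyer.BirchSwinnertonDyer.Cruxes.InertBadAtThree.RubinE1InertThree

open Summit.BirchSwinnertonDyer.BirchSwinnertonDyer.Theses
open Summit.BirchSwinnertonDyer.BirchSwinnertonDyer.Theorems
open Summit.BirchSwinnertonDyer.Rank1Residual
open Summit.BirchSwinnertonDyer.BirchSwinnertonDyer.Theorems.InertBadSignedBranchesInertBadAtThreeManinOfKatoThree
  (nine_dvd_conductorNorm_of_hasCM_of_not_good)

/-! ## The statements shared with line `bed_at_three` v5 (texts VERBATIM = `Lines/bed_at_three.lean` v5, lead bsd-line-ibd-p1) -/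

/-- E_K′@3 — BED item `EisensteinDivisibilityCMInertBadFlatAtOneKPrime` (stmt …-E_K′, rank 2 of BED) with `5 ≤ p`
replaced by `p = 3`, NOTHING else changed: granted Hsieh's `μ = 0` fact (Thm B, any level), at a CM-inert bad `p = 3`,
a Heegner field `K′` with `|d_{K′}| > 4`, `3 ∤ h_{K′}`, `L(E^{K′},1) ≠ 0`, an anticyclotomic `(κ, γ)`, a degree-one
`𝔭 ∋ 3` and the OTHER prime `𝔭′ ∋ 3` with `X_ac^{𝔭′}` torsion, and ANY ♭-frame `(f, ι′, Ω, Ω_p, Q)`: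
`char(X_ac^{𝔭′})(0) ∣ Q(0)` in `𝓞_{ℂ_3}`. The research content of the line (see module docstring: Hsieh 2014
Lemma 7.15 / Prop 7.16 are the two places `p ≠ 3` is used). -/
def HeartAtThree : Prop :=
  Literature.NumberTheory.EllipticCurves.Hsieh2014.thmB_exists_isHsiehLFunction_coeff_norm_eq_one_unrPeriod_anyLevel → ∀ (W : WeierstrassCurve ℚ) [W.IsElliptic] [W.IsGloballyMinimal] (p : ℕ) [Fact p.Prime] [NeZero (W.conductorNorm ℤ)] (K : Type) [Field K] [NumberField K], W.HasCM → W.analyticRank = 1 → p = 3 → Literature.NumberTheory.EllipticCurves.Rank1Residual.CMInert W p → ¬ Literature.NumberTheory.EllipticCurves.Rank1Residual.Good W p → Literature.NumberTheory.EllipticCurves.IsImaginaryQuadratic K → Literature.NumberTheory.EllipticCurves.SatisfiesHeegnerHypothesis (W.conductorNorm ℤ) K → 4 < (NumberField.discr K).natAbs → ¬ p ∣ NumberField.classNumber K → (W.quadraticTwist (NumberField.discr K : ℚ)).entireLFunction 1 ≠ 0 → ∀ (κ : Literature.NumberTheory.EllipticCurves.ZpExtension K p), κ.IsAnticyclotomic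 → ∀ (γ : Field.absoluteGaloisGroup K) [Fact (κ.IsTopGenerator γ)] (𝔭 : IsDedekindDomain.HeightOneSpectrum (NumberField.RingOfIntegers K)), ((p : ℕ) : NumberField.RingOfIntegers K) ∈ 𝔭.asIdeal → 𝔭.asIdeal.ramificationIdx (NumberField.RingOfIntegers ℚ) = 1 → 𝔭.asIdeal.inertiaDeg (NumberField.RingOfIntegers ℚ) = 1 → ∀ (𝔭' : IsDedekindDomain.HeightOneSpectrum (NumberField.RingOfIntegers K)), ((p : ℕ) : NumberField.RingOfIntegers K) ∈ 𝔭'.asIdeal → 𝔭' ≠ 𝔭 → Module.IsTorsion (Literature.NumberTheory.EllipticCurves.IwasawaAlgebra p) (Summit.BirchSwinnertonDyer.Rank1Residual.X11b.AcSelmer.XAc (W.baseChange K) p κ 𝔭' ∅ γ) → ∀ (f : CuspForm (CongruenceSubgroup.Gamma0 (W.conductorNorm ℤ)) 2), Literature.NumberTheory.EllipticCurves.ModularForms.IsNewformOf W f → ∀ (ι' : PadicAlgCl p ≃+* ℂ), (∀ (w : NumberField.InfinitePlace K) (k : NumberField.RingOfIntegers K), k ∈ 𝔭.asIdeal ↔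 ‖ι'.symm (w.embedding (k : K))‖ < 1) → ∀ (ΩK : ℂ) (Ωp : (Literature.NumberTheory.EllipticCurves.unrIntegers p)ˣ) (Q : PowerSeries (PadicComplexInt p)), ΩK ≠ 0 → Summit.BirchSwinnertonDyer.Rank1Residual.X11b.R1.IsBDPLFunctionInt p ι' 𝔭 κ γ f ΩK ((Ωp : Literature.NumberTheory.EllipticCurves.unrIntegers p) : (PadicComplex p)) Q → (Summit.BirchSwinnertonDyer.Rank1Residual.X11b.AcSelmer.XAc.charIdeal (W.baseChange K) p κ 𝔭' ∅ γ).map ((Summit.BirchSwinnertonDyer.Rank1Residual.X11b.R1.toCpInt p).comp (PowerSeries.constantCoeff : Literature.NumberTheory.EllipticCurves.IwasawaAlgebra p →+* ℤ_[p])) ≤ Ideal.span {PowerSeries.constantCoeff Q}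

/-- R₃ — BED item `ManinDatumFiveSevenCMInert` (R₅₇) with `(p = 5 ∨ p = 7)` replaced by `p = 3`: for an optimal
(lattice-unscaled) parametrisation datum of a CM curve of analytic rank one with CM-inert bad `3`, `3 ∤ c(Dt)`. The `I_n*`
cell is in tree (`WAll.AltClosersManinCells.maninDatum_of_kodairaSymbolAt_eq_Istar`, any `p ≠ 2`); the residual cells are
the Kodaira types III / III* at 3 (the `j = 1728` quartic twists; `j = 0` is CM-ramified at 3, hence excluded). -/
def ManinAtThree : Prop :=
  ∀ (W : WeierstrassCurve ℚ) [W.IsElliptic] [W.IsGloballyMinimal] [NeZero (W.conductorNorm ℤ)] (p : ℕ) [Fact p.Prime] (D : Literature.NumberTheory.EllipticCurves.ModularForms.ModularParametrizationData W (W.conductorNorm ℤ)), W.HasCM → W.analyticRank = 1 → p = 3 → Literature.NumberTheory.EllipticCurves.Rank1Residual.CMInert W p → ¬ Literature.NumberTheory.EllipticCurves.Rank1Residual.Good W p → (∀ z ∈ D.L.lattice, ∃ w ∈ Literature.NumberTheory.EllipticCurves.ModularForms.periodLattice D.f, z = D.c * w) → ¬ (p : ℤ) ∣ D.c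

/-- R₃ on the QUARTIC cell — the v3 RESIDUAL of `ManinAtThree`: the same conclusion for the pairs with `j(W) = 1728` and
Kodaira type `III` or `III*` at the place `v` of `ℤ` over `3` (the quartic twists `y² = x³ + a x`, `v₃(a)` odd; CM by `ℤ[i]`, `3`
inert). For a CM-inert bad `3` this is EXACTLY the off-`I₀*` cell (`…ManinCells.not_hasSignedLocalType_IstarZero_iff_quartic`, bed-w2
g7, p617415), i.e. K8's held child `InertBadAtThreeOffIstarZero` (stmt-19657)'s corner; the `I₀*` cell is closed in the tree
(`…BedManinIstar.not_dvd_c_of_hasSignedLocalType_Istar`). Text = the `hRes` binder of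
`InertBadSignedBranchesInertBadAtThreeManinCells.maninAtThree_of_facts_of_quarticResidual`, fully qualified. v3: «no source»
(Edixhoven 1991 Thm 3: additive `p ≥ 11`; Česnavičius 2018 / Česnavičius–Neururer–Saha 2024: semistable primes / `v₃(c) ≤ v₃(deg φ)`).
v4: a THEOREM modulo Kato's `p = 3` statement (`maninAtThreeQuartic_of_katoFact` below) — the CM-inert cell lies in the
`W[3]`-IRREDUCIBLE locus of route `ManinLocalTwoThree`'s `p = 3` lever. -/
def ManinAtThreeQuartic : Prop :=
  ∀ (W : WeierstrassCurve ℚ) [W.IsElliptic] [W.IsGloballyMinimal] [NeZero (W.conductorNorm ℤ)] (p : ℕ) [Fact p.Prime] (D : Literature.NumberTheory.EllipticCurves.ModularForms.ModularParametrizationData W (W.conductorNorm ℤ)) (v : IsDedekindDomain.HeightOneSpectrum ℤ), Rat.HeightOneSpectrum.natGenerator v = p → W.HasCM → W.analyticRank = 1 → p = 3 → Literature.NumberTheory.EllipticCurves.Rank1Residual.CMInert W p → ¬ Literature.NumberTheory.EllipticCurves.Rank1Residual.Good W p → (∀ z ∈ D.L.lattice, ∃ w ∈ Literature.NumberTheory.EllipticCurves.ModularForms.periodLattice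 D.f, z = D.c * w) → (W.j = 1728 ∧ (W.kodairaSymbolAt v = Literature.NumberTheory.DiophantineGeometry.KodairaSymbol.III ∨ W.kodairaSymbolAt v = Literature.NumberTheory.DiophantineGeometry.KodairaSymbol.IIIstar)) → ¬ (p : ℤ) ∣ D.c

/-- C⁺odd(N,3) — the `p = 3`, odd-discriminant twin of line size_tail's C⁺ (item 21381): for every level `N ≠ 0` the
square-free `d` that are discriminants of imaginary quadratic `K` with `|d| > 4`, `d` odd, every `ℓ ∣ N` split in `K`
and `3 ∤ h_K` are NOT a null set (tree currency `twistDensity … 0`). IN PRINT (Davenport–Heilbronn with local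
conditions: Nakagawa–Horie 1988 Thm 1, Bhargava–Shankar–Tsimerman 2013 Thm 2, Bhargava–Varma 2016): liminf of the
proportion with `3 ∤ h` in the box is `≥ 1/2`; the box has positive density among square-free integers. Untyped in
`Literature/` (a cite/definition request rides with the card). -/
def NonNullOddIndivisibleHeegnerThree : Prop :=
  ∀ (N : ℕ), N ≠ 0 → ¬ Literature.NumberTheory.EllipticCurves.twistDensity (fun d : ℤ ↦ ∃ (K : Type) (_ : Field K) (_ : NumberField K), Literature.NumberTheory.EllipticCurves.IsImaginaryQuadratic K ∧ NumberField.discr K = d ∧ 4 < d.natAbs ∧ Odd d ∧ Literature.NumberTheory.EllipticCurves.SatisfiesHeegnerHypothesis N K ∧ ¬ 3 ∣ NumberField.classNumber K) 0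

/-- The refereed / published inputs the chain consumes BY NAME (HELD as print; no research content). v2 =
(v1's seven: BED's `PublishedInputsBiquadratic` conjunction (GZ, Kolyvagin, Matar–Nekovář, GZK, modularity ×2,
Friedberg–Hoffstein, Rubin's BSD triple, Edixhoven, Deuring, Cassels), Hsieh 2014 Thm A and Thm B (any level),
Liu–Zhang–Zhang 2018, and the three inputs of the density-one switch (Burungale–Tian `p`-converse at 2 for CM
curves, Monsky parity, Smith's distribution)) ∧ the Davenport–Heilbronn mean with Heegner local conditions
(Bhargava–Varma 2016 Cor. 4 (a), `QuadraticFields.bv_threeTorsion_mean_imaginary_heegnerOdd`). v5 (lead g5): the three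
Manin print facts of BED's R₅₇ split (`MazurManinOdd`, `AbbesUllmoManinGood`, `CesnaviciusManinTwo`), conjuncts of v2–v4, are
DROPPED — the Manin input R₃ now comes entirely from Kato's `p = 3` statement (`maninAtThree_of_katoFact`). -/
def PrintedInputsAtThree : Prop :=
  (BiquadraticEisensteinDescent.PublishedInputsBiquadratic ∧ BiquadraticEisensteinDescent.HsiehAnyLevelInput ∧
    BiquadraticEisensteinDescent.HsiehMuInvariantInput ∧ BiquadraticEisensteinDescent.LiuZhangZhangAdditiveInput ∧
    Literature.NumberTheory.EllipticCurves.burungaleTian_analyticRank_eq_zero_of_selmerCorank_eq_zero_of_hasCM ∧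
    Literature.NumberTheory.EllipticCurves.monsky_selmerCorank_two_mod_two_eq ∧
    (∀ (W : WeierstrassCurve ℚ) [W.IsElliptic], W.HasCM → Literature.NumberTheory.EllipticCurves.smith_selmerCorank_density W)) ∧
    Literature.NumberTheory.QuadraticFields.bv_threeTorsion_mean_imaginary_heegnerOdd


/-- The HELD print of THIS line: v5's `PrintedInputsAtThree` ∧ the three printed Manin facts of BED's R₅₇ split (route
`BiquadraticEisensteinDescent` items, print: Mazur 1978 Cor. 4.1; Abbes–Ullmo 1996 Thm A; Česnavičius 2018 Thm 1.2) ∧ modularity with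
level = conductor (`ModularForms.exists_isNewformOf`, Wiles/BCDT + Carayol) — the inputs of bed-w2 g7's
`InertBadSignedBranchesInertBadAtThreeManinCells.maninAtThree_of_facts_of_quarticResidual` for the `Iₙ*` cell. HELD, never a worker target.
[cite: Mazur1978, Cor. 4.1] [cite: BreuilConradDiamondTaylor2001, Thm. A] -/
def PrintedInputsAtThreeCM : Prop :=
  PrintedInputsAtThree ∧ (BiquadraticEisensteinDescent.MazurManinOdd ∧ BiquadraticEisensteinDescent.AbbesUllmoManinGood ∧
    BiquadraticEisensteinDescent.CesnaviciusManinTwo ∧ Literature.NumberTheory.EllipticCurves.ModularForms.exists_isNewformOf)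

/-- **v8: THE HELD PRINT OF THIS LINE, ITEMISED** — the conjunction of exactly the named print facts the `p = 3` composition
`InertBadAtThree_bed_of_min` / `InertBadAtThree_proof` consumes, grouped (A) descent / analytic inputs: Gross–Zagier 1986 (family), Kolyvagin 1990 (family),
Matar–Nekovář 2019 Thm 0.3 (family), GZK `rank_eq_analyticRank_of_analyticRank_le_one`, modularity `exists_isNewformOf` (BCDT Thm A +
Carayol), Friedberg–Hoffstein 1995, Rubin's CM BSD triple `bsdTriple_of_hasCM_of_L_one_ne_zero`, Cassels' isogeny invariance
`bsdRHS_eq_of_isIsogenous`; (B) Hsieh Doc. Math. 19 (2014) Thm A / Thm B (any level), Liu–Zhang–Zhang 2018 Thms 1.5.1/1.5.3; (C) the odd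
density-one switch: Burungale–Tian `p`-converse (CM), Monsky parity, Smith's distribution (CM), and the Bhargava–Varma mean with Heegner
local conditions `bv_threeTorsion_mean_imaginary_heegnerOdd`; (D) the three printed Manin facts (Mazur 1978 Cor. 4.1, Abbes–Ullmo 1996
Thm A, Česnavičius 2018 Thm 1.2) for the `Iₙ*` cell; (E) the two print facts behind the tied Katz line frame V2@3: Katz 1978 (5.3.0) /
Hida–Tilouine 1993 Thm II in Hsieh's normalisation `hsieh2014mu_prop49_exists_isMeasure`, and Deuring's Grössencharacter
`Deuring_exists_heckeCharacter_of_maximalCM`. DROPPED w.r.t. v7's `PrintedInputsAtThreeCM` (kernel-idle at `p = 3` on this line, see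
`…BedGlueMin`): Edixhoven 1991 `edixhoven_not_dvd_maninConstant_of_not_potentiallyGoodOrdinary`, Deuring's supersingular criterion
`deuring_not_hasUnitRootAt_of_hasCM_of_not_cmSplit` (a tree theorem anyway), `hasEntireLFunction_rat` (derived from modularity), and the
duplicate copy of `exists_isNewformOf`. HELD, never a worker target; every conjunct is a by-name Literature `def … : Prop` with a locator.
[cite: BreuilConradDiamondTaylor2001, Thm. A] [cite: Hsieh2014, Thm. A and Thm. B p. 712 (Doc. Math. 19)] [cite: Katz1978, Thm. 5.3.0] -/
def PrintedInputsAtThreeMin : Prop :=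
  ((∀ (N : ℕ) [NeZero N] (W : WeierstrassCurve ℚ) (K : Type) [Field K] [NumberField K],
      Literature.NumberTheory.EllipticCurves.gross_zagier N W K) ∧
    (∀ (N : ℕ) [NeZero N] (W : WeierstrassCurve ℚ) (K : Type) [Field K] [NumberField K],
      Literature.NumberTheory.EllipticCurves.kolyvagin N W K) ∧
    (∀ (N : ℕ) [NeZero N] (W : WeierstrassCurve ℚ) (K : Type) [Field K] [NumberField K],
      Literature.NumberTheory.EllipticCurves.MatarNekovar2019.thm03_padicValNat_card_sha_le_of_irreducible N W K) ∧
    Literature.NumberTheory.EllipticCurves.rank_eq_analyticRank_of_analyticRank_le_one ∧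
    Literature.NumberTheory.EllipticCurves.ModularForms.exists_isNewformOf ∧
    Literature.NumberTheory.EllipticCurves.friedbergHoffstein_exists_heegnerField_split_twist_ne_zero ∧
    Literature.NumberTheory.EllipticCurves.bsdTriple_of_hasCM_of_L_one_ne_zero ∧
    WeierstrassCurve.bsdRHS_eq_of_isIsogenous) ∧
  (Literature.NumberTheory.EllipticCurves.Hsieh2014.thmA_exists_isHsiehLFunction_unrPeriod_anyLevel ∧
    Literature.NumberTheory.EllipticCurves.Hsieh2014.thmB_exists_isHsiehLFunction_coeff_norm_eq_one_unrPeriod_anyLevel ∧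
    Literature.NumberTheory.EllipticCurves.LiuZhangZhang2018.thm151_thm153_modularCurve_heegnerVector_additive) ∧
  (Literature.NumberTheory.EllipticCurves.burungaleTian_analyticRank_eq_zero_of_selmerCorank_eq_zero_of_hasCM ∧
    Literature.NumberTheory.EllipticCurves.monsky_selmerCorank_two_mod_two_eq ∧
    (∀ (W : WeierstrassCurve ℚ) [W.IsElliptic], W.HasCM → Literature.NumberTheory.EllipticCurves.smith_selmerCorank_density W) ∧
    Literature.NumberTheory.QuadraticFields.bv_threeTorsion_mean_imaginary_heegnerOdd) ∧
  (Literature.NumberTheory.EllipticCurves.ModularForms.mazur_not_dvd_maninConstant_of_odd ∧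
    Literature.NumberTheory.EllipticCurves.ModularForms.abbesUllmo_not_dvd_maninConstant_of_not_dvd_level ∧
    Literature.NumberTheory.EllipticCurves.ModularForms.cesnavicius_not_two_dvd_maninConstant_of_two_dvd_level) ∧
  (Literature.NumberTheory.EllipticCurves.hsieh2014mu_prop49_exists_isMeasure ∧
    Literature.NumberTheory.EllipticCurves.Deuring_exists_heckeCharacter_of_maximalCM)

/-- **Dominance (v8's held stub is WEAKER than v7's held stub plus V2's two print facts)**: `PrintedInputsAtThreeCM ∧ Katz ∧ Deuring ⟹
PrintedInputsAtThreeMin` — projections only. [cite: Katz1978, Thm. 5.3.0] -/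
theorem printedInputsAtThreeMin_of (hI : PrintedInputsAtThreeCM)
    (hKatz : Literature.NumberTheory.EllipticCurves.hsieh2014mu_prop49_exists_isMeasure)
    (hD : Literature.NumberTheory.EllipticCurves.Deuring_exists_heckeCharacter_of_maximalCM) : PrintedInputsAtThreeMin := by
  obtain ⟨⟨⟨⟨hGZ, hKo, hMN, hGZK, -, hnf, hFH, hCM8, -, -, hCassels⟩, h8, h9, h10, hBT, hMon, hSmith⟩, hBV⟩,
    hMaz, hAU, hCes, -⟩ := hI
  exact ⟨⟨hGZ, hKo, hMN, hGZK, hnf, hFH, hCM8, hCassels⟩, ⟨h8, h9, h10⟩, ⟨hBT, hMon, hSmith, hBV⟩, ⟨hMaz, hAU, hCes⟩, ⟨hKatz, hD⟩⟩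

/-! ## The statements of THIS line (typed in `RUBIN_E1_INERT_THREE_Sketch_bsd_idea_18_g6.lean`, rc 0; bodies VERBATIM) -/

/-- F-es-18 with the curve FIXED: for THIS globally minimal `V`, additive at `3` with `V[3]` irreducible, every primitive `χ` mod `m`,
`(m, 3N) = 1`, `χ ≠ 1`, `3 ∤ ord χ`, `χ(3) ∉ {1, −1}`: the symmetrised Birch–Manin twisted value is `3`-integral against the NÉRON
periods of `V` (body VERBATIM after the `V` binders of `kato_neron_isIntegral_twistedSymbolSum_of_additive_three_polar`;
`katoFact_iff_forall`). [cite: Kato2004Asterisque, (8.1.3) (p. 180), Thm. 9.7 (p. 189), Thm. 6.6 (1) (p. 163)] -/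
def NeronIntegralThreePolarAt (V : WeierstrassCurve ℚ) [V.IsElliptic] [V.IsGloballyMinimal] : Prop :=
  ∀ {N : ℕ} [NeZero N]
    (f : CuspForm (Gamma0 N) 2) (_ : IsNewformOf V f)
    (_ : ¬ V.HasGoodReductionAtPrime 3) (_ : ¬ V.HasMultiplicativeReductionAtPrime 3)
    (_ : V.HasIrreducibleModPGaloisRep 3) (m : ℕ) [NeZero m] (_ : m.Coprime (3 * N))
    (χ : DirichletCharacter ℂ m) (_ : χ.IsPrimitive) (_ : χ ≠ 1) (_ : ¬ 3 ∣ orderOf χ)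
    (_ : χ (3 : ZMod m) ≠ 1) (_ : χ (3 : ZMod m) ≠ -1) (ϖ : ℚ) (r : ℂ),
    (χ.Even → (ϖ : ℝ) * V.realPeriodRat = plusPeriod f →
      (∏ ℓ ∈ N.primeFactors with ¬ ℓ ^ 2 ∣ N,
          (((ℓ : ℂ) - (V.LFunction ℓ : ℂ) * χ (ℓ : ZMod m)) *
            ((ℓ : ℂ) - (V.LFunction ℓ : ℂ) * (χ (ℓ : ZMod m))⁻¹))) *
          twistedSymbolSum f χ = r * (plusPeriod f : ℂ) →
      ∃ s : ℕ, ¬ 3 ∣ s ∧ IsIntegral ℤ ((s : ℂ) * ϖ * r)) ∧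
    (χ.Odd → (ϖ : ℝ) * V.imaginaryPeriodRat = minusPeriod f →
      (∏ ℓ ∈ N.primeFactors with ¬ ℓ ^ 2 ∣ N,
          (((ℓ : ℂ) - (V.LFunction ℓ : ℂ) * χ (ℓ : ZMod m)) *
            ((ℓ : ℂ) - (V.LFunction ℓ : ℂ) * (χ (ℓ : ZMod m))⁻¹))) *
          twistedSymbolSum f χ = r * (minusPeriod f : ℂ) * Complex.I →
      ∃ s : ℕ, ¬ 3 ∣ s ∧ IsIntegral ℤ ((s : ℂ) * ϖ * r))

/-- The named fact F-es-18 IS the conjunction of its pointwise instances (definitional). -/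
theorem katoFact_iff_forall :
    kato_neron_isIntegral_twistedSymbolSum_of_additive_three_polar ↔
      ∀ (V : WeierstrassCurve ℚ) [V.IsElliptic] [V.IsGloballyMinimal], NeronIntegralThreePolarAt V :=
  Iff.rfl

/-- **C⁺_quartic (the transfer target; stub `stub_neronIntegralThreeQuartic`).** F-es-18's conclusion on the quartic cell
`j = 1728` (CM by `ℤ[i]`, `3` inert) bad at `3` — the quartic twists `y² = x³ − Dx`, `3 ∣ D`, Kodaira III / III* / I₀* at `3` — where the
tree's PROVED finite formula `GaussianLattice.thetaLFunction_one_eq_sum_kroneckerE₁` (Rubin LNM 1716 Prop. 7.15 at `k = 1`, `K = ℚ(i)`)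
applies. Proof scheme (memo EPSILON-RESOLVED §§1–8): Birch (`twisted_LValue_eq_holds`) + IR 18.5 dictionary + finite formula +
𝔞-smoothing (termwise `3`-integrality by reduction of composite-order torsion on `y² = x³ − x`) + the μ₈-resolvent count on its
Lubin–Tate group at `3`: surviving exponents `n ≡ 8 − 2k (mod 8)` give exactly the deficit `1 − k/4`, `k = v₃(D)`.
[cite: Rubin1999, Prop. 7.15] [cite: IrelandRosen1990, Ch. 18 §4 Thm. 5] -/
def NeronIntegralThreeQuartic : Prop :=
  ∀ (V : WeierstrassCurve ℚ) [V.IsElliptic] [V.IsGloballyMinimal],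
    V.j = 1728 → ¬ V.HasGoodReductionAtPrime 3 → NeronIntegralThreePolarAt V

/-- **C⁺_quartic, PLAIN ODD FORM (v5 registered stub's statement)** — exactly what the datum-level lever consumes on the quartic cell:
`3`-integrality in Néron units of the ODD twisted symbol sums of the conductor-level newform, prime moduli `ℓ ∤ N_V`, `ℓ ≡ 11 (mod 12)`,
`χ(3) ≠ 1`. Weaker than `NeronIntegralThreeQuartic` (`plainOddQuartic_of_neronIntegralThreeQuartic`). By Birch's formula
(`ModularForms.twisted_LValue_eq_holds`) the quantity is `τ(χ)·L(V, χ̄, 1)/(Ω⁻(V)·i)` up to the `3`-unit `m₀ ∈ {1, 2}`.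
[cite: Kato2004Asterisque, Thm. 9.7 (p. 189)] [cite: MazurTateTeitelbaum1986, §I.8 (8.6)] -/
def PlainOddNeronIntegralThreeQuartic : Prop :=
  ∀ (V : WeierstrassCurve ℚ) [V.IsElliptic] [V.IsGloballyMinimal] [NeZero (V.conductorNorm ℤ)],
    V.j = 1728 → ¬ V.HasGoodReductionAtPrime 3 →
    ∀ (f : CuspForm (CongruenceSubgroup.Gamma0 (V.conductorNorm ℤ)) 2),
      Literature.NumberTheory.EllipticCurves.ModularForms.IsNewformOf V f →
      ∀ (ℓ : ℕ) [NeZero ℓ], ℓ.Prime → ¬ ℓ ∣ V.conductorNorm ℤ → ℓ % 12 = 11 →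
        ∀ χ : DirichletCharacter ℂ ℓ, χ.Odd → χ (3 : ZMod ℓ) ≠ 1 →
          ∀ (ϖ : ℚ) (r : ℂ),
            (ϖ : ℝ) * V.imaginaryPeriodRat = Literature.NumberTheory.EllipticCurves.ModularForms.minusPeriod f →
            Literature.NumberTheory.EllipticCurves.ModularForms.twistedSymbolSum f χ =
              r * (Literature.NumberTheory.EllipticCurves.ModularForms.minusPeriod f : ℂ) * Complex.I →
            ∃ s : ℕ, ¬ 3 ∣ s ∧ IsIntegral ℤ ((s : ℂ) * ϖ * r)

/-- **S1 (a THEOREM, `pointwiseKatoShiftLever` below, via the lead's p624535): the POINTWISE Kato shift lever** — route `ManinLocalTwoThree`'s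
`Rank1Residual.ManinAdditive.KatoShiftTwistManinThree` with the pointwise Néron-integrality of THE curve `W` as hypothesis
(refactor of `Theorems.ManinLocalTwoThree.katoShiftTwistManinThree_of_katoFact`, whose proof uses the global fact only at `V = W`,
`…ManinPrimeToThreeAtNineKatoShiftLever.pint_charSum_div_three'` l. 173; generation input = tree theorem `shiftClassGenerationThree_holds`).
[cite: Mazur1978, §6 Prop. 6.3 (1) (p. 153)] -/
def PointwiseKatoShiftLever : Prop :=
  ∀ (W : WeierstrassCurve ℚ) [W.IsElliptic] [W.IsGloballyMinimal] {N : ℕ} [NeZero N]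
    (D : ModularParametrizationData W N),
    NeronIntegralThreePolarAt W →
    (∀ z ∈ D.L.lattice, ∃ w ∈ periodLattice D.f, z = D.c * w) → 3 ^ 2 ∣ N →
    W.HasIrreducibleModPGaloisRep 3 → ¬ (3 : ℤ) ∣ D.c

/-! ## Stubs, part 1 (v8: the itemised held print; the quartic stub is a theorem; V2@3 is a theorem and V4K@3 the research stub in § «v7: the heart cut» below) -/

/-- STUB (HELD, print only — never a worker target; REGISTERED v8, replaces v7's `stub_printedInputsAtThreeCM`): `PrintedInputsAtThreeMin`,
the itemised print of this line (twenty named facts, each used). [cite: BreuilConradDiamondTaylor2001, Thm. A] -/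
theorem stub_printedInputsAtThreeMin : PrintedInputsAtThreeMin := by
  sorry

/-- v6: PROVED (tree theorem `InertBadSignedBranchesInertBadAtThreeQuarticStub.stub_plainOddNeronIntegralThreeQuartic`, p632832). Was: STUB (rank 2,
REGISTERED v5; size L–XL as formalisation / classical mathematics; signature = the body of
`PlainOddNeronIntegralThreeQuartic` INLINE, tree constants only): the PLAIN ODD form of C⁺_quartic. Roads: (a) restriction of F-es-18
(`plainOddQuartic_of_katoFact`); (b) the CM side (card + EPSILON-RESOLVED §§1–8, now only for odd `χ` of prime conductor `ℓ ≡ 11 (12)`: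
the minus-period branch). Cheapest falsifier: a `3` in the denominator of `τ(χ)L(E_D, χ̄, 1)/(Ω⁻ i)` for one quartic twist
`y² = x³ − Dx`, `3 ∣ D`, `χ` odd of prime conductor `ℓ ≡ 11 (mod 12)`, `χ(3) ≠ 1` (E3-NUMERICS-bsd-idea-18-g6: 0 violations in 52 pairs).
[cite: Kato2004Asterisque, (8.1.3) (p. 180), Thm. 9.7 (p. 189), Thm. 6.6 (1) (p. 163)] [cite: Rubin1999LNM1716, Prop. 7.15] -/
theorem stub_plainOddNeronIntegralThreeQuartic :
    ∀ (V : WeierstrassCurve ℚ) [V.IsElliptic] [V.IsGloballyMinimal] [NeZero (V.conductorNorm ℤ)],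
      V.j = 1728 → ¬ V.HasGoodReductionAtPrime 3 →
      ∀ (f : CuspForm (CongruenceSubgroup.Gamma0 (V.conductorNorm ℤ)) 2),
        Literature.NumberTheory.EllipticCurves.ModularForms.IsNewformOf V f →
        ∀ (ℓ : ℕ) [NeZero ℓ], ℓ.Prime → ¬ ℓ ∣ V.conductorNorm ℤ → ℓ % 12 = 11 →
          ∀ χ : DirichletCharacter ℂ ℓ, χ.Odd → χ (3 : ZMod ℓ) ≠ 1 →
            ∀ (ϖ : ℚ) (r : ℂ),
              (ϖ : ℝ) * V.imaginaryPeriodRat = Literature.NumberTheory.EllipticCurves.ModularForms.minusPeriod f →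
              Literature.NumberTheory.EllipticCurves.ModularForms.twistedSymbolSum f χ =
                r * (Literature.NumberTheory.EllipticCurves.ModularForms.minusPeriod f : ℂ) * Complex.I →
              ∃ s : ℕ, ¬ 3 ∣ s ∧ IsIntegral ℤ ((s : ℂ) * ϖ * r) :=
  -- v6: LANDED (p632832) — the STUB-PLAN wave's closer; no `sorry`.
  InertBadSignedBranchesInertBadAtThreeQuarticStub.stub_plainOddNeronIntegralThreeQuartic

/-- The registered v5 stub IS `PlainOddNeronIntegralThreeQuartic` (definitional). -/
theorem plainOddQuartic_of_stub : PlainOddNeronIntegralThreeQuartic :=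
  stub_plainOddNeronIntegralThreeQuartic

/-! ## S1 is a theorem (lead's helper p624535) and dominance of the remaining new stub -/

/-- **S1 `PointwiseKatoShiftLever` — PROVED**: the pointwise Kato shift lever is the tree theorem
`InertBadSignedBranchesInertBadAtThreePointwiseKatoLever.not_three_dvd_c_of_neronIntegralAt` (lead bsd-line-ibd-p1 g6, p624535; unconditional,
generation input `shiftClassGenerationThree_holds`). [cite: Mazur1978, §6 Prop. 6.3 (1) (p. 153)] -/
theorem pointwiseKatoShiftLever : PointwiseKatoShiftLever := by
  intro W _ _ N _ D hW hopt h9 hirr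
  exact InertBadSignedBranchesInertBadAtThreePointwiseKatoLever.not_three_dvd_c_of_neronIntegralAt D hW hopt h9 hirr

/-- The lead's announced v6 stub shape (REQUESTS 10:22:41Z; companion helper
`Theorems/InertBadSignedBranchesInertBadAtThreeManinOfNeronIntegralCMInert.lean`): the F-es-18 instances on the whole CM-inert-at-`3`
bad class (six CM fields). Recorded here only to make the comparison kernel-exact. -/
def NeronIntegralThreeCMInert : Prop :=
  ∀ (V : WeierstrassCurve ℚ) [V.IsElliptic] [V.IsGloballyMinimal],
    V.HasCM → CMInert V 3 → ¬ Good V 3 → NeronIntegralThreePolarAt V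

/-- **C⁺_CMInert ⇒ C⁺_quartic** (this line's stub is the weaker target): a globally minimal curve with `j = 1728` has CM
(`WeierstrassCurve.hasCM_of_j_eq_1728`) with `3` CM-inert (`X12.cmInert_three_of_j_eq_1728`). -/
theorem neronIntegralThreeQuartic_of_neronIntegralCMInert (h : NeronIntegralThreeCMInert) : NeronIntegralThreeQuartic :=
  fun V _ _ hj hbad ↦ h V (WeierstrassCurve.hasCM_of_j_eq_1728 V hj) (X12.cmInert_three_of_j_eq_1728 V hj) hbad

/-- C⁺_quartic from the global fact (specialisation). -/
theorem neronIntegralThreeQuartic_of_katoFact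
    (hK : kato_neron_isIntegral_twistedSymbolSum_of_additive_three_polar) : NeronIntegralThreeQuartic :=
  fun V _ _ _ _ ↦ hK V

/-- **C⁺_quartic (v4) ⇒ the plain odd form (v5)**: at conductor level the symmetrised Euler factor of a CM curve is `1`
(p626343 `symmEuler_eq_one_of_hasCM`; `j = 1728 ⇒ CM` by `WeierstrassCurve.hasCM_of_j_eq_1728`), an odd `χ` mod a prime `ℓ ≡ 11 (mod 12)`
is primitive, `≠ 1`, of order prime to `3`, with `χ(3) ≠ −1` (`ManinLocalTwoThree.isPrimitive_of_odd`, `ne_one_of_odd`, `not_three_dvd_orderOf`,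
`apply_three_ne_neg_one`), and a bad `3` of a CM curve is additive. [cite: SilvermanATAEC1994, IV.10.2(c)] -/
theorem plainOddQuartic_of_neronIntegralThreeQuartic (h : NeronIntegralThreeQuartic) : PlainOddNeronIntegralThreeQuartic := by
  intro V _ _ _ hj hbad f hf ℓ _ hℓ hℓN h12 χ hχ hχ3 ϖ r hϖ hval
  haveI : Fact ℓ.Prime := ⟨hℓ⟩
  have hCM : V.HasCM := WeierstrassCurve.hasCM_of_j_eq_1728 V hj
  obtain ⟨-, -, -, -, hℓ3, -⟩ := ManinLocalTwoThree.mod_twelve_facts (ℓ := ℓ) h12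
  have hm : ℓ.Coprime (3 * V.conductorNorm ℤ) := Nat.Coprime.mul_right
    ((Nat.coprime_primes hℓ Nat.prime_three).mpr hℓ3) ((hℓ.coprime_iff_not_dvd).mpr hℓN)
  have hmult : ¬ V.HasMultiplicativeReductionAtPrime 3 := V.not_hasMultiplicativeReductionAtPrime_of_hasCM hCM 3
  have hirr : V.HasIrreducibleModPGaloisRep 3 :=
    X12.irr_of_cmInert V 3 (by norm_num) (X12.cmInert_three_of_j_eq_1728 V hj)
  have hval' : (∏ q ∈ (V.conductorNorm ℤ).primeFactors with ¬ q ^ 2 ∣ V.conductorNorm ℤ,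
      (((q : ℂ) - (V.LFunction q : ℂ) * χ (q : ZMod ℓ)) * ((q : ℂ) - (V.LFunction q : ℂ) * (χ (q : ZMod ℓ))⁻¹))) *
      twistedSymbolSum f χ = r * (minusPeriod f : ℂ) * Complex.I := by
    rw [InertBadSignedBranchesInertBadAtThreeOddPrimeInstances.symmEuler_eq_one_of_hasCM V hCM χ, one_mul]
    exact hval
  exact (h V hj hbad f hf hbad hmult hirr ℓ hm χ (ManinLocalTwoThree.isPrimitive_of_odd hχ)
    (ManinLocalTwoThree.ne_one_of_odd hχ) (ManinLocalTwoThree.not_three_dvd_orderOf h12 χ) hχ3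
    (ManinLocalTwoThree.apply_three_ne_neg_one h12 χ) ϖ r).2 hχ hϖ hval'

/-- The plain odd form from the global fact F-es-18 (one `_holds` of F-es-18 still closes the v5 stub; debt shared with 22968).
[cite: Kato2004Asterisque, Thm. 9.7 (p. 189)] -/
theorem plainOddQuartic_of_katoFact
    (hK : kato_neron_isIntegral_twistedSymbolSum_of_additive_three_polar) : PlainOddNeronIntegralThreeQuartic :=
  plainOddQuartic_of_neronIntegralThreeQuartic (neronIntegralThreeQuartic_of_katoFact hK)

/-! ## The sorry-free links -/

/-- **v1's C⁺odd(N,3) from the printed inputs** (the BV mean conjunct, p615210). [cite: BhargavaVarma2016, Cor. 4 (a)] -/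
theorem nonNullOddIndivisibleHeegnerThree_of_printedInputs (hI : PrintedInputsAtThreeCM) :
    NonNullOddIndivisibleHeegnerThree :=
  InertBadSignedBranchesInertBadAtThreeNonNullOddHeegner.nonNullOddIndivisibleHeegnerThree_of_mean hI.1.2

/-- **The quartic-cell Manin statement `ManinAtThreeQuartic` (v3's stub, VERBATIM) from S1 ∧ C⁺_quartic** — the pointwise lever at
`W` fed with the pointwise Néron integrality of `W` (`j(W) = 1728` from the cell hypothesis, `¬ Good W 3` is `¬ W.HasGoodReductionAtPrime 3`
by `rfl`), `9 ∣ N_W` (p620851 `nine_dvd_conductorNorm_of_hasCM_of_not_good`) and `W[3]` irreducible (`X12.irr_of_cmInert`).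
[cite: Mazur1978, §6 Prop. 6.3 (1) (p. 153)] -/
theorem maninAtThreeQuartic_of_pointwiseLever_of_quarticFact (hL : PointwiseKatoShiftLever)
    (hC : NeronIntegralThreeQuartic) : ManinAtThreeQuartic := by
  intro W _ _ _ p _ D v _ hCM _ h3 hin hbad hopt hq
  subst h3
  exact hL W D (hC W hq.1 hbad) hopt (nine_dvd_conductorNorm_of_hasCM_of_not_good W hCM hbad)
    (X12.irr_of_cmInert W 3 (by norm_num) hin)

/-- **v5: the quartic-cell Manin statement `ManinAtThreeQuartic` from the PLAIN ODD form** — p626343's datum-level lever for CM curves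
`not_three_dvd_c_of_plainOddInstances_of_hasCM`, fed with the stub at `V := W`, `f := D.f`.
[cite: Mazur1978, §6 Prop. 6.3 (1) (p. 153)] -/
theorem maninAtThreeQuartic_of_plainOddQuartic (hC : PlainOddNeronIntegralThreeQuartic) : ManinAtThreeQuartic := by
  intro W _ _ _ p _ D v _ hCM _ h3 hin hbad hopt hq
  subst h3
  exact InertBadSignedBranchesInertBadAtThreeOddPrimeInstances.not_three_dvd_c_of_plainOddInstances_of_hasCM W D hopt hCM hin hbad
    (fun ℓ _ hℓ hℓN h12 χ hχ hχ3 ϖ r hϖ hval ↦ hC W hq.1 hbad D.f D.isNewformOf ℓ hℓ hℓN h12 χ hχ hχ3 ϖ r hϖ hval)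

/-- **v5: R₃ `ManinAtThree` from the held print and the PLAIN ODD quartic statement.** [cite: Stevens1989, Lemmas (5.2), (5.4)] [cite: Mazur1978, Cor. 4.1] -/
theorem maninAtThree_of_printedInputs_of_plainOddQuartic (hI : PrintedInputsAtThreeCM) (hC : PlainOddNeronIntegralThreeQuartic) :
    ManinAtThree :=
  InertBadSignedBranchesInertBadAtThreeManinCells.maninAtThree_of_facts_of_quarticResidual hI.2.1 hI.2.2.1 hI.2.2.2.1 hI.2.2.2.2
    (maninAtThreeQuartic_of_plainOddQuartic hC)

/-- **R₃ `ManinAtThree` from the held print and C⁺_quartic** (S1 being a theorem): the `Iₙ*` cell by the printed Manin facts + modularity (bed-w2 g7's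
`maninAtThree_of_facts_of_quarticResidual`, p617415), the quartic III/III* cell by `maninAtThreeQuartic_of_pointwiseLever_of_quarticFact`.
[cite: Stevens1989, Lemmas (5.2), (5.4)] [cite: Mazur1978, Cor. 4.1] -/
theorem maninAtThree_of_printedInputs_of_quarticFact (hI : PrintedInputsAtThreeCM) (hC : NeronIntegralThreeQuartic) : ManinAtThree :=
  InertBadSignedBranchesInertBadAtThreeManinCells.maninAtThree_of_facts_of_quarticResidual hI.2.1 hI.2.2.1 hI.2.2.2.1 hI.2.2.2.2
    (maninAtThreeQuartic_of_pointwiseLever_of_quarticFact pointwiseKatoShiftLever hC)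

/-! ## v7: the heart cut along BED's `hsieh_lambda` at `p = 3` (lead g8)

The research stub `stub_heartAtThree` of v5/v6 is proved from the held print and the two new registered stubs below, through the lead's
landed helpers p635870 (`heartAtThree_of_heartFlatAtThree`) and p636175 (`heartFlatAtThree_of_parts`). Texts of the new stubs = BED's
registered `stub_V2` / `stub_V4K` of crux 21341 (`Cruxes/EisensteinHeartFlatCMInertBadKPrime/Lines/hsieh_lambda.lean` v3 cc08ae10) with
`5 ≤ p` ↦ `p = 3`, stated INLINE (tree constants only) so that a `Theorems/` closer can state the identical signature under the same `open`s. -/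

section HeartCut

open NumberField IsDedekindDomain Field PowerSeries
  Literature.NumberTheory.EllipticCurves.Hsieh2014
  Literature.NumberTheory.EllipticCurves.GreenbergSelmer
  Literature.NumberTheory.EllipticCurves.Module
  Literature.NumberTheory.EllipticCurves.IwasawaDual
  Literature.NumberTheory.GaloisRepresentations
  Summit.BirchSwinnertonDyer.Rank1Residual.X11b
  Summit.BirchSwinnertonDyer.Rank1Residual.X11b.AcSelmer
  Summit.BirchSwinnertonDyer.BirchSwinnertonDyer.Theorems.BiquadraticEisensteinDescentDefs
  Summit.BirchSwinnertonDyer.BirchSwinnertonDyer.Theorems.BiquadraticEisensteinDescentEisensteinHeartFlatCMInertBadKPrimeSelmerTower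
  Summit.BirchSwinnertonDyer.BirchSwinnertonDyer.Theorems.BiquadraticEisensteinDescentEisensteinHeartFlatCMInertBadKPrimeShapiroDatum
  Summit.BirchSwinnertonDyer.BirchSwinnertonDyer.Theorems.BiquadraticEisensteinDescentEisensteinHeartFlatCMInertBadKPrimeCMDatumAdapter

/-- **♭-heart@3** — BED's crux `EisensteinHeartFlatCMInertBadKPrime` (stmt-21341, the ♭-HEART over `K′`, μ-blind: `∃ m, p^m · Ch_Λ(X_𝔭′) ·
𝓞_ℂp⟦T⟧ ⊆ (Q)` for every ♭-frame `Q`) with `5 ≤ p` replaced by `p = 3`, NOTHING else changed. E_K′@3 (`HeartAtThree`) follows from it and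
Hsieh's Thm B (p635870). [cite: Hsieh2014JAMS, Thm. 8.14] [cite: Castella2018, Thm. 3.1 (arXiv:1704.06608 p. 9)] -/
def HeartFlatAtThree : Prop :=
    ∀ (W : WeierstrassCurve ℚ) [W.IsElliptic] [W.IsGloballyMinimal] (p : ℕ) [Fact p.Prime]
      [NeZero (W.conductorNorm ℤ)] (K : Type) [Field K] [NumberField K],
      W.HasCM → W.analyticRank = 1 → p = 3 → CMInert W p → ¬ Good W p →
      IsImaginaryQuadratic K → SatisfiesHeegnerHypothesis (W.conductorNorm ℤ) K →
      4 < (NumberField.discr K).natAbs →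
      ¬ p ∣ NumberField.classNumber K →
      (W.quadraticTwist (NumberField.discr K : ℚ)).entireLFunction 1 ≠ 0 →
      ∀ (κ : ZpExtension K p), κ.IsAnticyclotomic →
        ∀ (γ : Field.absoluteGaloisGroup K) [Fact (κ.IsTopGenerator γ)]
          (𝔭 : HeightOneSpectrum (𝓞 K)), ((p : ℕ) : 𝓞 K) ∈ 𝔭.asIdeal →
          𝔭.asIdeal.ramificationIdx (𝓞 ℚ) = 1 → 𝔭.asIdeal.inertiaDeg (𝓞 ℚ) = 1 →
          ∀ (f : CuspForm (CongruenceSubgroup.Gamma0 (W.conductorNorm ℤ)) 2), IsNewformOf W f →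
            ∀ (ι' : PadicAlgCl p ≃+* ℂ),
              (∀ (w : InfinitePlace K) (k : 𝓞 K), k ∈ 𝔭.asIdeal ↔ ‖ι'.symm (w.embedding (k : K))‖ < 1) →
              ∀ (ΩK : ℂ) (Ωp : (unrIntegers p)ˣ) (Q : PowerSeries (PadicComplexInt p)), ΩK ≠ 0 →
                R1.IsBDPLFunctionInt p ι' 𝔭 κ γ f ΩK ((Ωp : unrIntegers p) : (PadicComplex p)) Q →
                  ∀ (𝔭' : HeightOneSpectrum (𝓞 K)), ((p : ℕ) : 𝓞 K) ∈ 𝔭'.asIdeal → 𝔭' ≠ 𝔭 →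
                  Module.IsTorsion (IwasawaAlgebra p) (XAc (W.baseChange K) p κ 𝔭' ∅ γ) →
                  ∃ m : ℕ, ∀ x ∈ (XAc.charIdeal (W.baseChange K) p κ 𝔭' ∅ γ).map (PowerSeries.map (R1.toCpInt p)),
                    (PowerSeries.C ((p : ℕ) : PadicComplexInt p) : PowerSeries (PadicComplexInt p)) ^ m * x ∈
                      Ideal.span {Q}

/-- **V2@3 — a TIED KATZ LINE FRAME EXISTS at the route's datum, `p = 3`** (BED's registered `stub_V2` text at `p = 3`): for the crux data
`(W, 3, K′, κ, γ, 𝔭, f, ι′)` and the other prime `𝔭′`, a number field `L ⊇ K′` (`= K′·K_CM`) with Katz datum `(Σ_p = Sp, S, T, ϑ)`, the branch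
character `λ`, Katz periods and a LINE SERIES `G` with `KatzCM.IsBaseChangeLine …`, tied to `W` by (T) Katz type, (C) continuation, (L)
`L(0, λχ_L) = c_L c_L′ⁿ · RS(f ⊗ χ, 1)`, (R) ramification, non-vanishing. PRINT BY NAME + typing (Katz 1978 / Hida–Tilouine 1993 existence
`hsieh2014mu_prop49_exists_isMeasure`, Deuring); BED's conditional closer p625968 (`…StubV2AllJ.stub_V2_of_katz_of_deuring`, via
`…TiedFrame.exists_tiedFrame_of_frame`) uses `5 ≤ p` only as `p ≠ 2` / `2 < p`. [cite: Katz1978, Thm. 5.3.0] [cite: HidaTilouine1993, §4 Thm. II] -/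
def TiedKatzFrameAtThree : Prop :=
    ∀ (W : WeierstrassCurve ℚ) [W.IsElliptic] [W.IsGloballyMinimal] (p : ℕ) [Fact p.Prime]
      [NeZero (W.conductorNorm ℤ)] (K : Type) [Field K] [NumberField K],
      W.HasCM → p = 3 → CMInert W p → ¬ Good W p →
      IsImaginaryQuadratic K → SatisfiesHeegnerHypothesis (W.conductorNorm ℤ) K →
      4 < (NumberField.discr K).natAbs → ¬ p ∣ NumberField.classNumber K →
      ∀ (κ : ZpExtension K p), κ.IsAnticyclotomic →
        ∀ (γ : Field.absoluteGaloisGroup K) [Fact (κ.IsTopGenerator γ)]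
          (𝔭 : HeightOneSpectrum (𝓞 K)), ((p : ℕ) : 𝓞 K) ∈ 𝔭.asIdeal →
          𝔭.asIdeal.ramificationIdx (𝓞 ℚ) = 1 → 𝔭.asIdeal.inertiaDeg (𝓞 ℚ) = 1 →
          ∀ (f : CuspForm (CongruenceSubgroup.Gamma0 (W.conductorNorm ℤ)) 2), IsNewformOf W f →
            ∀ (ι' : PadicAlgCl p ≃+* ℂ),
              (∀ (w : InfinitePlace K) (k : 𝓞 K), k ∈ 𝔭.asIdeal ↔ ‖ι'.symm (w.embedding (k : K))‖ < 1) →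
                  ∀ (𝔭' : HeightOneSpectrum (𝓞 K)), ((p : ℕ) : 𝓞 K) ∈ 𝔭'.asIdeal → 𝔭' ≠ 𝔭 →
                  ∃ (L : Type) (_ : Field L) (_ : NumberField L) (_ : Algebra K L) (_ : IsGalois K L)
                    (Sp S T : Finset (HeightOneSpectrum (𝓞 L))) (lam : HeckeCharacter L) (ϑ : L) (CK : ℂ)
                    (Ω : InfinitePlace L → ℂ) (ΩpK : InfinitePlace L → ℂ_[p]) (G : PowerSeries 𝓞_ℂ_[p])
                    (w₁ w₂ : InfinitePlace L) (cL cL' : ℂ),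
                    w₁ ≠ w₂ ∧ (∀ w : InfinitePlace L, w = w₁ ∨ w = w₂) ∧
                    (∀ (χ : HeckeCharacter K) (n : ℕ), 0 < n → (∀ v : HeightOneSpectrum (𝓞 K), χ.IsUnramifiedAt v) →
                      χ.HasInfinityType (fun _ ↦ (n : ℤ)) (fun _ ↦ -(n : ℤ)) →
                      KatzCM.HasKatzType ι' Sp (lam * χ.compRelNorm L) 1 (fun w ↦ if w = w₁ then n else n - 1)) ∧
                    (∀ (χ : HeckeCharacter K) (n : ℕ), 0 < n → (∀ v : HeightOneSpectrum (𝓞 K), χ.IsUnramifiedAt v) →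
                      χ.HasInfinityType (fun _ ↦ (n : ℤ)) (fun _ ↦ -(n : ℤ)) →
                      LFunction.HasEntireContinuation (heckeLFunction (lam * χ.compRelNorm L))) ∧
                    cL ≠ 0 ∧ cL' ≠ 0 ∧
                    (∀ (χ : HeckeCharacter K) (n : ℕ), 0 < n → (∀ v : HeightOneSpectrum (𝓞 K), χ.IsUnramifiedAt v) →
                      χ.HasInfinityType (fun _ ↦ (n : ℤ)) (fun _ ↦ -(n : ℤ)) →
                      ∀ hL : LFunction.HasEntireContinuation (heckeLFunction (lam * χ.compRelNorm L)),
                        hL.continuation 0 = cL * cL' ^ n * rankinSelbergValueHecke f χ 1) ∧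
                    (∀ w ∈ S ∪ KatzCM.primesOver L p, ¬ lam.IsUnramifiedAt w) ∧
                    (∀ w ∈ Sp ∪ T, ¬ lam.IsUnramifiedAt w) ∧
                    CK ≠ 0 ∧ (∀ w, Ω w ≠ 0) ∧ (∀ w, (KatzCM.embeddingAt ι' Sp w ϑ).im ≠ 0) ∧ (∀ w, ΩpK w ≠ 0) ∧
                    KatzCM.IsBaseChangeLine ι' Sp S T κ γ lam ϑ CK Ω ΩpK G

/-- **V4K@3 — THE INPUT at `p = 3`** (BED's registered `stub_V4K` text at `p = 3`): for the crux data, every tied Katz line frame `G`,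
`X_ac(W/K′)_{𝔭′-str}` Λ-torsion, every `[√d₀]` datum and `U = Stab(√d₀) = Γ_L`, and every admissible `(φ, γ′, f₁, h, δ, b, ι)`:
`∃ m, 3^m · Ch_{𝒪⟦T⟧}(N) · 𝓞_ℂ₃⟦T⟧ ⊆ (G)`, `N = X_L(ψ̂_L)` with its `𝒪 = ℤ₃[√d₀]`-structure — Hsieh JAMS 27 (2014) Thm 8.14 for the branch
`Ψ = ψ_W ∘ N_{L/K_CM}` (`Σ_p = {𝔓′}`) on the `K′`-anticyclotomic line, read in `Λ ⊗ ℚ`, AT `p = 3`. RESEARCH, NOT IN PRINT: BED's wall (Hsieh's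
hyp (2) / BHTY's (ii) fail on the `p`-ramified tame branch; the λ-part needs (I′) = the Λ-adic Murase–Sugano identity / local integral `J_{v₀}`)
PLUS rider R1 at `p = 3` (JAMS Lemma 7.15 / Prop. 7.16 use `p > 3`; acq-13882). [cite: Hsieh2014JAMS, Thm. 8.14, L.7.15, P.7.16] -/
def KatzLineDivisibilityAtThree : Prop :=
    ∀ (W : WeierstrassCurve ℚ) [W.IsElliptic] [W.IsGloballyMinimal] (p : ℕ) [Fact p.Prime]
      [NeZero (W.conductorNorm ℤ)] (K : Type) [Field K] [NumberField K],
      W.HasCM → p = 3 → CMInert W p → ¬ Good W p →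
      IsImaginaryQuadratic K → SatisfiesHeegnerHypothesis (W.conductorNorm ℤ) K →
      4 < (NumberField.discr K).natAbs → ¬ p ∣ NumberField.classNumber K →
      ∀ (κ : ZpExtension K p), κ.IsAnticyclotomic →
        ∀ (γ : Field.absoluteGaloisGroup K) [Fact (κ.IsTopGenerator γ)]
          (𝔭 : HeightOneSpectrum (𝓞 K)), ((p : ℕ) : 𝓞 K) ∈ 𝔭.asIdeal →
          𝔭.asIdeal.ramificationIdx (𝓞 ℚ) = 1 → 𝔭.asIdeal.inertiaDeg (𝓞 ℚ) = 1 →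
          ∀ (f : CuspForm (CongruenceSubgroup.Gamma0 (W.conductorNorm ℤ)) 2), IsNewformOf W f →
            ∀ (ι' : PadicAlgCl p ≃+* ℂ),
              (∀ (w : InfinitePlace K) (k : 𝓞 K), k ∈ 𝔭.asIdeal ↔ ‖ι'.symm (w.embedding (k : K))‖ < 1) →
                  ∀ (𝔭' : HeightOneSpectrum (𝓞 K)), ((p : ℕ) : 𝓞 K) ∈ 𝔭'.asIdeal → 𝔭' ≠ 𝔭 →
                  Module.IsTorsion (IwasawaAlgebra p) (XAc (W.baseChange K) p κ 𝔭' ∅ γ) →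
                  ∀ (L : Type) [Field L] [NumberField L] [Algebra K L] [IsGalois K L]
                    (Sp S T : Finset (HeightOneSpectrum (𝓞 L))) (lam : HeckeCharacter L) (ϑ : L) (CK : ℂ)
                    (Ω : InfinitePlace L → ℂ) (ΩpK : InfinitePlace L → ℂ_[p]) (G : PowerSeries 𝓞_ℂ_[p])
                    (w₁ w₂ : InfinitePlace L) (cL cL' : ℂ),
                    w₁ ≠ w₂ → (∀ w : InfinitePlace L, w = w₁ ∨ w = w₂) →
                    (∀ (χ : HeckeCharacter K) (n : ℕ), 0 < n → (∀ v : HeightOneSpectrum (𝓞 K), χ.IsUnramifiedAt v) →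
                      χ.HasInfinityType (fun _ ↦ (n : ℤ)) (fun _ ↦ -(n : ℤ)) →
                      KatzCM.HasKatzType ι' Sp (lam * χ.compRelNorm L) 1 (fun w ↦ if w = w₁ then n else n - 1)) →
                    (∀ (χ : HeckeCharacter K) (n : ℕ), 0 < n → (∀ v : HeightOneSpectrum (𝓞 K), χ.IsUnramifiedAt v) →
                      χ.HasInfinityType (fun _ ↦ (n : ℤ)) (fun _ ↦ -(n : ℤ)) →
                      LFunction.HasEntireContinuation (heckeLFunction (lam * χ.compRelNorm L))) →
                    cL ≠ 0 → cL' ≠ 0 →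
                    (∀ (χ : HeckeCharacter K) (n : ℕ), 0 < n → (∀ v : HeightOneSpectrum (𝓞 K), χ.IsUnramifiedAt v) →
                      χ.HasInfinityType (fun _ ↦ (n : ℤ)) (fun _ ↦ -(n : ℤ)) →
                      ∀ hL : LFunction.HasEntireContinuation (heckeLFunction (lam * χ.compRelNorm L)),
                        hL.continuation 0 = cL * cL' ^ n * rankinSelbergValueHecke f χ 1) →
                    (∀ w ∈ S ∪ KatzCM.primesOver L p, ¬ lam.IsUnramifiedAt w) →
                    (∀ w ∈ Sp ∪ T, ¬ lam.IsUnramifiedAt w) →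
                    CK ≠ 0 → (∀ w, Ω w ≠ 0) → (∀ w, (KatzCM.embeddingAt ι' Sp w ϑ).im ≠ 0) → (∀ w, ΩpK w ≠ 0) →
                    KatzCM.IsBaseChangeLine ι' Sp S T κ γ lam ϑ CK Ω ΩpK G →
                  ∀ (d₀ : ℤ) (r : AlgebraicClosure K) (ψ : (W.baseChange K).geomPoints →+ (W.baseChange K).geomPoints),
                    r * r = algebraMap K (AlgebraicClosure K) (d₀ : K) →
                    r ∉ Set.range (algebraMap K (AlgebraicClosure K)) →
                    (∀ y : ZMod p, y * y ≠ PadicInt.toZMod ((d₀ : ℤ) : ℤ_[p])) →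
                    (∀ σ : absoluteGaloisGroup K, σ • r = r → ∀ P : (W.baseChange K).geomPoints, σ • ψ P = ψ (σ • P)) →
                    (∀ σ : absoluteGaloisGroup K, σ • r = -r → ∀ P : (W.baseChange K).geomPoints, σ • ψ P = -ψ (σ • P)) →
                    (∀ P, ψ (ψ P) = d₀ • P) →
                  ∀ (U : Subgroup (absoluteGaloisGroup K)) [U.Normal], (∀ σ, σ ∈ U ↔ σ • r = r) →
                  ∀ (φ : (W.baseChange K).geomPrimaryTorsion p →+ (W.baseChange K).geomPrimaryTorsion p)
                    (_ : ∀ m, ((φ m : (W.baseChange K).geomPrimaryTorsion p) : (W.baseChange K).geomPoints) = ψ m)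
                    (hφH' : ∀ (x : (κ.kerSubgroup ⊓ U : Subgroup (absoluteGaloisGroup K)))
                      (m : (W.baseChange K).geomPrimaryTorsion p), φ (x • m) = x • φ m)
                    (hφU : ∀ σ ∈ U, ∀ m : (W.baseChange K).geomPrimaryTorsion p, φ (σ • m) = σ • φ m)
                    (hφU' : ∀ σ, σ ∉ U → ∀ m : (W.baseChange K).geomPrimaryTorsion p, φ (σ • m) = -(σ • φ m))
                    (hφ2 : ∀ m, φ (φ m) = d₀ • m)
                    (γ' : absoluteGaloisGroup K) (_ : κ.IsTopGenerator γ') (_ : γ' ∈ U)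
                    (f₁ : AddMonoid.End (selmerOver (κ.kerSubgroup ⊓ U) ((W.baseChange K).geomPrimaryTorsion p) p 𝔭' ∅))
                    (_hf : ∀ s, ((f₁ s : selmerOver (κ.kerSubgroup ⊓ U) ((W.baseChange K).geomPrimaryTorsion p) p 𝔭' ∅) :
                      subgroupH1 (κ.kerSubgroup ⊓ U) ((W.baseChange K).geomPrimaryTorsion p)) =
                        conjH1 (κ.kerSubgroup ⊓ U) ((W.baseChange K).geomPrimaryTorsion p) γ' s)
                    (h : IsLocNil p (f₁ - 1))
                    (δ : LocNilDual (selmerOver (κ.kerSubgroup ⊓ U) ((W.baseChange K).geomPrimaryTorsion p) p 𝔭' ∅) f₁ h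
                      →ₗ[IwasawaAlgebra p]
                      LocNilDual (selmerOver (κ.kerSubgroup ⊓ U) ((W.baseChange K).geomPrimaryTorsion p) p 𝔭' ∅) f₁ h)
                    (hδ : ∀ (x : LocNilDual (selmerOver (κ.kerSubgroup ⊓ U) ((W.baseChange K).geomPrimaryTorsion p) p 𝔭' ∅) f₁ h)
                      (s t : selmerOver (κ.kerSubgroup ⊓ U) ((W.baseChange K).geomPrimaryTorsion p) p 𝔭' ∅),
                      (t : subgroupH1 (κ.kerSubgroup ⊓ U) ((W.baseChange K).geomPrimaryTorsion p)) =
                        resH1Hom (ContinuousMonoidHom.id _) φ hφH'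
                          (s : subgroupH1 (κ.kerSubgroup ⊓ U) ((W.baseChange K).geomPrimaryTorsion p)) → δ x s = x t)
                    (b : Module.Basis (Fin 2) ℤ_[p]
                      (AdjoinRoot (Polynomial.X ^ 2 - Polynomial.C ((d₀ : ℤ) : ℤ_[p]) : Polynomial ℤ_[p]))) (hb0 : b 0 = 1)
                    (hb1 : b 1 * b 1 = algebraMap ℤ_[p]
                      (AdjoinRoot (Polynomial.X ^ 2 - Polynomial.C ((d₀ : ℤ) : ℤ_[p]) : Polynomial ℤ_[p])) ((d₀ : ℤ) : ℤ_[p]))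
                    (ι : AdjoinRoot (Polynomial.X ^ 2 - Polynomial.C ((d₀ : ℤ) : ℤ_[p]) : Polynomial ℤ_[p]) →+* 𝓞_ℂ_[p])
                    (_ : ι.comp (algebraMap ℤ_[p] _) = R1.toCpInt p),
                    ∃ m : ℕ, ∀ x ∈ (charIdeal (PowerSeries
                        (AdjoinRoot (Polynomial.X ^ 2 - Polynomial.C ((d₀ : ℤ) : ℤ_[p]) : Polynomial ℤ_[p])))
                        (WithQuadratic (LocNilDual (selmerOver (κ.kerSubgroup ⊓ U) ((W.baseChange K).geomPrimaryTorsion p)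
                          p 𝔭' ∅) f₁ h) b hb0 hb1 δ
                          (delta_sq (W.baseChange K) κ 𝔭' ∅ U φ hφH' hφU hφU' d₀ hφ2 f₁ h δ hδ))).map (PowerSeries.map ι),
                      (PowerSeries.C ((p : ℕ) : 𝓞_ℂ_[p]) : PowerSeries 𝓞_ℂ_[p]) ^ m * x ∈ Ideal.span {G}

/-- **v8: V2@3 from the itemised held print** — the lead's p637355 `…HeartStubV2.stub_tiedKatzFrameAtThree_of_katz_of_deuring` fed with
conjuncts (E) (Katz's measure, Deuring's Grössencharacter) of `PrintedInputsAtThreeMin`. [cite: Katz1978, Thm. 5.3.0] [cite: HidaTilouine1993, §4 Thm. II] -/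
theorem tiedKatzFrameAtThree_of_printedInputs (hI : PrintedInputsAtThreeMin) : TiedKatzFrameAtThree :=
  InertBadSignedBranchesInertBadAtThreeHeartStubV2.stub_tiedKatzFrameAtThree_of_katz_of_deuring hI.2.2.2.2.1 hI.2.2.2.2.2

/-- v8: A THEOREM of the skeleton (from the itemised held print through `tiedKatzFrameAtThree_of_printedInputs`; no `sorry`). Was: STUB (rank 2,
REGISTERED v7 — print by name + typing; the `p = 3` twin of BED's `stub_V2`, signature = the body of `TiedKatzFrameAtThree`
INLINE): a tied Katz line frame exists at `p = 3`. CONDITIONALLY CLOSED by the lead's p637355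
`InertBadSignedBranchesInertBadAtThreeHeartStubV2.stub_tiedKatzFrameAtThree_of_katz_of_deuring (hKatz) (hD) : <this signature VERBATIM>`
(modulo `hsieh2014mu_prop49_exists_isMeasure` + `Deuring_exists_heckeCharacter_of_maximalCM`; BED's p625325/p625968 re-run at `p = 3` through
p636952 `…HeartTiedFrame.exists_tiedFrame_of_frame_of_ne_two`) — exactly the status of 21341's `stub_V2`; unconditional only by formalising Katz's measure.
[cite: Katz1978, Thm. 5.3.0] [cite: HidaTilouine1993, §4 Thm. II] -/
theorem stub_tiedKatzFrameAtThree :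
    ∀ (W : WeierstrassCurve ℚ) [W.IsElliptic] [W.IsGloballyMinimal] (p : ℕ) [Fact p.Prime]
      [NeZero (W.conductorNorm ℤ)] (K : Type) [Field K] [NumberField K],
      W.HasCM → p = 3 → CMInert W p → ¬ Good W p →
      IsImaginaryQuadratic K → SatisfiesHeegnerHypothesis (W.conductorNorm ℤ) K →
      4 < (NumberField.discr K).natAbs → ¬ p ∣ NumberField.classNumber K →
      ∀ (κ : ZpExtension K p), κ.IsAnticyclotomic →
        ∀ (γ : Field.absoluteGaloisGroup K) [Fact (κ.IsTopGenerator γ)]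
          (𝔭 : HeightOneSpectrum (𝓞 K)), ((p : ℕ) : 𝓞 K) ∈ 𝔭.asIdeal →
          𝔭.asIdeal.ramificationIdx (𝓞 ℚ) = 1 → 𝔭.asIdeal.inertiaDeg (𝓞 ℚ) = 1 →
          ∀ (f : CuspForm (CongruenceSubgroup.Gamma0 (W.conductorNorm ℤ)) 2), IsNewformOf W f →
            ∀ (ι' : PadicAlgCl p ≃+* ℂ),
              (∀ (w : InfinitePlace K) (k : 𝓞 K), k ∈ 𝔭.asIdeal ↔ ‖ι'.symm (w.embedding (k : K))‖ < 1) →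
                  ∀ (𝔭' : HeightOneSpectrum (𝓞 K)), ((p : ℕ) : 𝓞 K) ∈ 𝔭'.asIdeal → 𝔭' ≠ 𝔭 →
                  ∃ (L : Type) (_ : Field L) (_ : NumberField L) (_ : Algebra K L) (_ : IsGalois K L)
                    (Sp S T : Finset (HeightOneSpectrum (𝓞 L))) (lam : HeckeCharacter L) (ϑ : L) (CK : ℂ)
                    (Ω : InfinitePlace L → ℂ) (ΩpK : InfinitePlace L → ℂ_[p]) (G : PowerSeries 𝓞_ℂ_[p])
                    (w₁ w₂ : InfinitePlace L) (cL cL' : ℂ),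
                    w₁ ≠ w₂ ∧ (∀ w : InfinitePlace L, w = w₁ ∨ w = w₂) ∧
                    (∀ (χ : HeckeCharacter K) (n : ℕ), 0 < n → (∀ v : HeightOneSpectrum (𝓞 K), χ.IsUnramifiedAt v) →
                      χ.HasInfinityType (fun _ ↦ (n : ℤ)) (fun _ ↦ -(n : ℤ)) →
                      KatzCM.HasKatzType ι' Sp (lam * χ.compRelNorm L) 1 (fun w ↦ if w = w₁ then n else n - 1)) ∧
                    (∀ (χ : HeckeCharacter K) (n : ℕ), 0 < n → (∀ v : HeightOneSpectrum (𝓞 K), χ.IsUnramifiedAt v) →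
                      χ.HasInfinityType (fun _ ↦ (n : ℤ)) (fun _ ↦ -(n : ℤ)) →
                      LFunction.HasEntireContinuation (heckeLFunction (lam * χ.compRelNorm L))) ∧
                    cL ≠ 0 ∧ cL' ≠ 0 ∧
                    (∀ (χ : HeckeCharacter K) (n : ℕ), 0 < n → (∀ v : HeightOneSpectrum (𝓞 K), χ.IsUnramifiedAt v) →
                      χ.HasInfinityType (fun _ ↦ (n : ℤ)) (fun _ ↦ -(n : ℤ)) →
                      ∀ hL : LFunction.HasEntireContinuation (heckeLFunction (lam * χ.compRelNorm L)),
                        hL.continuation 0 = cL * cL' ^ n * rankinSelbergValueHecke f χ 1) ∧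
                    (∀ w ∈ S ∪ KatzCM.primesOver L p, ¬ lam.IsUnramifiedAt w) ∧
                    (∀ w ∈ Sp ∪ T, ¬ lam.IsUnramifiedAt w) ∧
                    CK ≠ 0 ∧ (∀ w, Ω w ≠ 0) ∧ (∀ w, (KatzCM.embeddingAt ι' Sp w ϑ).im ≠ 0) ∧ (∀ w, ΩpK w ≠ 0) ∧
                    KatzCM.IsBaseChangeLine ι' Sp S T κ γ lam ϑ CK Ω ΩpK G :=
  tiedKatzFrameAtThree_of_printedInputs stub_printedInputsAtThreeMin

/-- STUB (rank 1, HARDEST, REGISTERED v7 — THE INPUT, research; the `p = 3` twin of BED's `stub_V4K`, signature = the body of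
`KatzLineDivisibilityAtThree` INLINE): Hsieh JAMS14 Thm 8.14's divisibility for the `ψ_L`-branch module against the Katz line series, on the
`K′`-line, μ-blind, at `p = 3`. NOT IN PRINT (W-19 + rider R1). Cheapest falsifier: none known (no kernel object for `J_{v₀}`); BED's
HSIEH-AWAY-FROM-P-AUDIT / PART 2 and JV0-LOCAL-SPEC.md are the paper-level state. [cite: Hsieh2014JAMS, Thm. 8.14, L.7.15, P.7.16] -/
theorem stub_katzLineDivisibilityAtThree :
    ∀ (W : WeierstrassCurve ℚ) [W.IsElliptic] [W.IsGloballyMinimal] (p : ℕ) [Fact p.Prime]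
      [NeZero (W.conductorNorm ℤ)] (K : Type) [Field K] [NumberField K],
      W.HasCM → p = 3 → CMInert W p → ¬ Good W p →
      IsImaginaryQuadratic K → SatisfiesHeegnerHypothesis (W.conductorNorm ℤ) K →
      4 < (NumberField.discr K).natAbs → ¬ p ∣ NumberField.classNumber K →
      ∀ (κ : ZpExtension K p), κ.IsAnticyclotomic →
        ∀ (γ : Field.absoluteGaloisGroup K) [Fact (κ.IsTopGenerator γ)]
          (𝔭 : HeightOneSpectrum (𝓞 K)), ((p : ℕ) : 𝓞 K) ∈ 𝔭.asIdeal →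
          𝔭.asIdeal.ramificationIdx (𝓞 ℚ) = 1 → 𝔭.asIdeal.inertiaDeg (𝓞 ℚ) = 1 →
          ∀ (f : CuspForm (CongruenceSubgroup.Gamma0 (W.conductorNorm ℤ)) 2), IsNewformOf W f →
            ∀ (ι' : PadicAlgCl p ≃+* ℂ),
              (∀ (w : InfinitePlace K) (k : 𝓞 K), k ∈ 𝔭.asIdeal ↔ ‖ι'.symm (w.embedding (k : K))‖ < 1) →
                  ∀ (𝔭' : HeightOneSpectrum (𝓞 K)), ((p : ℕ) : 𝓞 K) ∈ 𝔭'.asIdeal → 𝔭' ≠ 𝔭 →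
                  Module.IsTorsion (IwasawaAlgebra p) (XAc (W.baseChange K) p κ 𝔭' ∅ γ) →
                  ∀ (L : Type) [Field L] [NumberField L] [Algebra K L] [IsGalois K L]
                    (Sp S T : Finset (HeightOneSpectrum (𝓞 L))) (lam : HeckeCharacter L) (ϑ : L) (CK : ℂ)
                    (Ω : InfinitePlace L → ℂ) (ΩpK : InfinitePlace L → ℂ_[p]) (G : PowerSeries 𝓞_ℂ_[p])
                    (w₁ w₂ : InfinitePlace L) (cL cL' : ℂ),
                    w₁ ≠ w₂ → (∀ w : InfinitePlace L, w = w₁ ∨ w = w₂) →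
                    (∀ (χ : HeckeCharacter K) (n : ℕ), 0 < n → (∀ v : HeightOneSpectrum (𝓞 K), χ.IsUnramifiedAt v) →
                      χ.HasInfinityType (fun _ ↦ (n : ℤ)) (fun _ ↦ -(n : ℤ)) →
                      KatzCM.HasKatzType ι' Sp (lam * χ.compRelNorm L) 1 (fun w ↦ if w = w₁ then n else n - 1)) →
                    (∀ (χ : HeckeCharacter K) (n : ℕ), 0 < n → (∀ v : HeightOneSpectrum (𝓞 K), χ.IsUnramifiedAt v) →
                      χ.HasInfinityType (fun _ ↦ (n : ℤ)) (fun _ ↦ -(n : ℤ)) →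
                      LFunction.HasEntireContinuation (heckeLFunction (lam * χ.compRelNorm L))) →
                    cL ≠ 0 → cL' ≠ 0 →
                    (∀ (χ : HeckeCharacter K) (n : ℕ), 0 < n → (∀ v : HeightOneSpectrum (𝓞 K), χ.IsUnramifiedAt v) →
                      χ.HasInfinityType (fun _ ↦ (n : ℤ)) (fun _ ↦ -(n : ℤ)) →
                      ∀ hL : LFunction.HasEntireContinuation (heckeLFunction (lam * χ.compRelNorm L)),
                        hL.continuation 0 = cL * cL' ^ n * rankinSelbergValueHecke f χ 1) →
                    (∀ w ∈ S ∪ KatzCM.primesOver L p, ¬ lam.IsUnramifiedAt w) →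
                    (∀ w ∈ Sp ∪ T, ¬ lam.IsUnramifiedAt w) →
                    CK ≠ 0 → (∀ w, Ω w ≠ 0) → (∀ w, (KatzCM.embeddingAt ι' Sp w ϑ).im ≠ 0) → (∀ w, ΩpK w ≠ 0) →
                    KatzCM.IsBaseChangeLine ι' Sp S T κ γ lam ϑ CK Ω ΩpK G →
                  ∀ (d₀ : ℤ) (r : AlgebraicClosure K) (ψ : (W.baseChange K).geomPoints →+ (W.baseChange K).geomPoints),
                    r * r = algebraMap K (AlgebraicClosure K) (d₀ : K) →
                    r ∉ Set.range (algebraMap K (AlgebraicClosure K)) →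
                    (∀ y : ZMod p, y * y ≠ PadicInt.toZMod ((d₀ : ℤ) : ℤ_[p])) →
                    (∀ σ : absoluteGaloisGroup K, σ • r = r → ∀ P : (W.baseChange K).geomPoints, σ • ψ P = ψ (σ • P)) →
                    (∀ σ : absoluteGaloisGroup K, σ • r = -r → ∀ P : (W.baseChange K).geomPoints, σ • ψ P = -ψ (σ • P)) →
                    (∀ P, ψ (ψ P) = d₀ • P) →
                  ∀ (U : Subgroup (absoluteGaloisGroup K)) [U.Normal], (∀ σ, σ ∈ U ↔ σ • r = r) →
                  ∀ (φ : (W.baseChange K).geomPrimaryTorsion p →+ (W.baseChange K).geomPrimaryTorsion p)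
                    (_ : ∀ m, ((φ m : (W.baseChange K).geomPrimaryTorsion p) : (W.baseChange K).geomPoints) = ψ m)
                    (hφH' : ∀ (x : (κ.kerSubgroup ⊓ U : Subgroup (absoluteGaloisGroup K)))
                      (m : (W.baseChange K).geomPrimaryTorsion p), φ (x • m) = x • φ m)
                    (hφU : ∀ σ ∈ U, ∀ m : (W.baseChange K).geomPrimaryTorsion p, φ (σ • m) = σ • φ m)
                    (hφU' : ∀ σ, σ ∉ U → ∀ m : (W.baseChange K).geomPrimaryTorsion p, φ (σ • m) = -(σ • φ m))
                    (hφ2 : ∀ m, φ (φ m) = d₀ • m)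
                    (γ' : absoluteGaloisGroup K) (_ : κ.IsTopGenerator γ') (_ : γ' ∈ U)
                    (f₁ : AddMonoid.End (selmerOver (κ.kerSubgroup ⊓ U) ((W.baseChange K).geomPrimaryTorsion p) p 𝔭' ∅))
                    (_hf : ∀ s, ((f₁ s : selmerOver (κ.kerSubgroup ⊓ U) ((W.baseChange K).geomPrimaryTorsion p) p 𝔭' ∅) :
                      subgroupH1 (κ.kerSubgroup ⊓ U) ((W.baseChange K).geomPrimaryTorsion p)) =
                        conjH1 (κ.kerSubgroup ⊓ U) ((W.baseChange K).geomPrimaryTorsion p) γ' s)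
                    (h : IsLocNil p (f₁ - 1))
                    (δ : LocNilDual (selmerOver (κ.kerSubgroup ⊓ U) ((W.baseChange K).geomPrimaryTorsion p) p 𝔭' ∅) f₁ h
                      →ₗ[IwasawaAlgebra p]
                      LocNilDual (selmerOver (κ.kerSubgroup ⊓ U) ((W.baseChange K).geomPrimaryTorsion p) p 𝔭' ∅) f₁ h)
                    (hδ : ∀ (x : LocNilDual (selmerOver (κ.kerSubgroup ⊓ U) ((W.baseChange K).geomPrimaryTorsion p) p 𝔭' ∅) f₁ h)
                      (s t : selmerOver (κ.kerSubgroup ⊓ U) ((W.baseChange K).geomPrimaryTorsion p) p 𝔭' ∅),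
                      (t : subgroupH1 (κ.kerSubgroup ⊓ U) ((W.baseChange K).geomPrimaryTorsion p)) =
                        resH1Hom (ContinuousMonoidHom.id _) φ hφH'
                          (s : subgroupH1 (κ.kerSubgroup ⊓ U) ((W.baseChange K).geomPrimaryTorsion p)) → δ x s = x t)
                    (b : Module.Basis (Fin 2) ℤ_[p]
                      (AdjoinRoot (Polynomial.X ^ 2 - Polynomial.C ((d₀ : ℤ) : ℤ_[p]) : Polynomial ℤ_[p]))) (hb0 : b 0 = 1)
                    (hb1 : b 1 * b 1 = algebraMap ℤ_[p]
                      (AdjoinRoot (Polynomial.X ^ 2 - Polynomial.C ((d₀ : ℤ) : ℤ_[p]) : Polynomial ℤ_[p])) ((d₀ : ℤ) : ℤ_[p]))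
                    (ι : AdjoinRoot (Polynomial.X ^ 2 - Polynomial.C ((d₀ : ℤ) : ℤ_[p]) : Polynomial ℤ_[p]) →+* 𝓞_ℂ_[p])
                    (_ : ι.comp (algebraMap ℤ_[p] _) = R1.toCpInt p),
                    ∃ m : ℕ, ∀ x ∈ (charIdeal (PowerSeries
                        (AdjoinRoot (Polynomial.X ^ 2 - Polynomial.C ((d₀ : ℤ) : ℤ_[p]) : Polynomial ℤ_[p])))
                        (WithQuadratic (LocNilDual (selmerOver (κ.kerSubgroup ⊓ U) ((W.baseChange K).geomPrimaryTorsion p)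
                          p 𝔭' ∅) f₁ h) b hb0 hb1 δ
                          (delta_sq (W.baseChange K) κ 𝔭' ∅ U φ hφH' hφU hφU' d₀ hφ2 f₁ h δ hδ))).map (PowerSeries.map ι),
                      (PowerSeries.C ((p : ℕ) : 𝓞_ℂ_[p]) : PowerSeries 𝓞_ℂ_[p]) ^ m * x ∈ Ideal.span {G} := by
  sorry


/-! ### v7.1: ONE statement for both cruxes — V4K at every odd prime -/

/-- **V4K for every ODD prime** — the registered research inputs of crux 19225 (`stub_katzLineDivisibilityAtThree`, `p = 3`) and of BED's
crux 21341 (`stub_V4K`, `5 ≤ p`) are the two instances of this ONE text (`p = 3` / `5 ≤ p` ↦ `p ≠ 2`): Hsieh JAMS 27 (2014) Thm 8.14's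
divisibility for the `ψ_L`-branch module against the Katz line series on the `K′`-line, μ-blind, at an odd CM-inert bad prime. Recorded so
that a planner can PROMOTE one item serving both routes (`katzLineDivisibilityAtThree_of_odd`, `bedStubV4K_of_odd` below are the kernel-exact
specialisations). RESEARCH, NOT IN PRINT (W-19; at `p = 3` also rider R1). [cite: Hsieh2014JAMS, Thm. 8.14, L.7.15, P.7.16] -/
def KatzLineDivisibilityOdd : Prop :=
    ∀ (W : WeierstrassCurve ℚ) [W.IsElliptic] [W.IsGloballyMinimal] (p : ℕ) [Fact p.Prime]
      [NeZero (W.conductorNorm ℤ)] (K : Type) [Field K] [NumberField K],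
      W.HasCM → p ≠ 2 → CMInert W p → ¬ Good W p →
      IsImaginaryQuadratic K → SatisfiesHeegnerHypothesis (W.conductorNorm ℤ) K →
      4 < (NumberField.discr K).natAbs → ¬ p ∣ NumberField.classNumber K →
      ∀ (κ : ZpExtension K p), κ.IsAnticyclotomic →
        ∀ (γ : Field.absoluteGaloisGroup K) [Fact (κ.IsTopGenerator γ)]
          (𝔭 : HeightOneSpectrum (𝓞 K)), ((p : ℕ) : 𝓞 K) ∈ 𝔭.asIdeal →
          𝔭.asIdeal.ramificationIdx (𝓞 ℚ) = 1 → 𝔭.asIdeal.inertiaDeg (𝓞 ℚ) = 1 →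
          ∀ (f : CuspForm (CongruenceSubgroup.Gamma0 (W.conductorNorm ℤ)) 2), IsNewformOf W f →
            ∀ (ι' : PadicAlgCl p ≃+* ℂ),
              (∀ (w : InfinitePlace K) (k : 𝓞 K), k ∈ 𝔭.asIdeal ↔ ‖ι'.symm (w.embedding (k : K))‖ < 1) →
                  ∀ (𝔭' : HeightOneSpectrum (𝓞 K)), ((p : ℕ) : 𝓞 K) ∈ 𝔭'.asIdeal → 𝔭' ≠ 𝔭 →
                  Module.IsTorsion (IwasawaAlgebra p) (XAc (W.baseChange K) p κ 𝔭' ∅ γ) →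
                  ∀ (L : Type) [Field L] [NumberField L] [Algebra K L] [IsGalois K L]
                    (Sp S T : Finset (HeightOneSpectrum (𝓞 L))) (lam : HeckeCharacter L) (ϑ : L) (CK : ℂ)
                    (Ω : InfinitePlace L → ℂ) (ΩpK : InfinitePlace L → ℂ_[p]) (G : PowerSeries 𝓞_ℂ_[p])
                    (w₁ w₂ : InfinitePlace L) (cL cL' : ℂ),
                    w₁ ≠ w₂ → (∀ w : InfinitePlace L, w = w₁ ∨ w = w₂) →
                    (∀ (χ : HeckeCharacter K) (n : ℕ), 0 < n → (∀ v : HeightOneSpectrum (𝓞 K), χ.IsUnramifiedAt v) →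
                      χ.HasInfinityType (fun _ ↦ (n : ℤ)) (fun _ ↦ -(n : ℤ)) →
                      KatzCM.HasKatzType ι' Sp (lam * χ.compRelNorm L) 1 (fun w ↦ if w = w₁ then n else n - 1)) →
                    (∀ (χ : HeckeCharacter K) (n : ℕ), 0 < n → (∀ v : HeightOneSpectrum (𝓞 K), χ.IsUnramifiedAt v) →
                      χ.HasInfinityType (fun _ ↦ (n : ℤ)) (fun _ ↦ -(n : ℤ)) →
                      LFunction.HasEntireContinuation (heckeLFunction (lam * χ.compRelNorm L))) →
                    cL ≠ 0 → cL' ≠ 0 →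
                    (∀ (χ : HeckeCharacter K) (n : ℕ), 0 < n → (∀ v : HeightOneSpectrum (𝓞 K), χ.IsUnramifiedAt v) →
                      χ.HasInfinityType (fun _ ↦ (n : ℤ)) (fun _ ↦ -(n : ℤ)) →
                      ∀ hL : LFunction.HasEntireContinuation (heckeLFunction (lam * χ.compRelNorm L)),
                        hL.continuation 0 = cL * cL' ^ n * rankinSelbergValueHecke f χ 1) →
                    (∀ w ∈ S ∪ KatzCM.primesOver L p, ¬ lam.IsUnramifiedAt w) →
                    (∀ w ∈ Sp ∪ T, ¬ lam.IsUnramifiedAt w) →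
                    CK ≠ 0 → (∀ w, Ω w ≠ 0) → (∀ w, (KatzCM.embeddingAt ι' Sp w ϑ).im ≠ 0) → (∀ w, ΩpK w ≠ 0) →
                    KatzCM.IsBaseChangeLine ι' Sp S T κ γ lam ϑ CK Ω ΩpK G →
                  ∀ (d₀ : ℤ) (r : AlgebraicClosure K) (ψ : (W.baseChange K).geomPoints →+ (W.baseChange K).geomPoints),
                    r * r = algebraMap K (AlgebraicClosure K) (d₀ : K) →
                    r ∉ Set.range (algebraMap K (AlgebraicClosure K)) →
                    (∀ y : ZMod p, y * y ≠ PadicInt.toZMod ((d₀ : ℤ) : ℤ_[p])) →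
                    (∀ σ : absoluteGaloisGroup K, σ • r = r → ∀ P : (W.baseChange K).geomPoints, σ • ψ P = ψ (σ • P)) →
                    (∀ σ : absoluteGaloisGroup K, σ • r = -r → ∀ P : (W.baseChange K).geomPoints, σ • ψ P = -ψ (σ • P)) →
                    (∀ P, ψ (ψ P) = d₀ • P) →
                  ∀ (U : Subgroup (absoluteGaloisGroup K)) [U.Normal], (∀ σ, σ ∈ U ↔ σ • r = r) →
                  ∀ (φ : (W.baseChange K).geomPrimaryTorsion p →+ (W.baseChange K).geomPrimaryTorsion p)
                    (_ : ∀ m, ((φ m : (W.baseChange K).geomPrimaryTorsion p) : (W.baseChange K).geomPoints) = ψ m)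
                    (hφH' : ∀ (x : (κ.kerSubgroup ⊓ U : Subgroup (absoluteGaloisGroup K)))
                      (m : (W.baseChange K).geomPrimaryTorsion p), φ (x • m) = x • φ m)
                    (hφU : ∀ σ ∈ U, ∀ m : (W.baseChange K).geomPrimaryTorsion p, φ (σ • m) = σ • φ m)
                    (hφU' : ∀ σ, σ ∉ U → ∀ m : (W.baseChange K).geomPrimaryTorsion p, φ (σ • m) = -(σ • φ m))
                    (hφ2 : ∀ m, φ (φ m) = d₀ • m)
                    (γ' : absoluteGaloisGroup K) (_ : κ.IsTopGenerator γ') (_ : γ' ∈ U)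
                    (f₁ : AddMonoid.End (selmerOver (κ.kerSubgroup ⊓ U) ((W.baseChange K).geomPrimaryTorsion p) p 𝔭' ∅))
                    (_hf : ∀ s, ((f₁ s : selmerOver (κ.kerSubgroup ⊓ U) ((W.baseChange K).geomPrimaryTorsion p) p 𝔭' ∅) :
                      subgroupH1 (κ.kerSubgroup ⊓ U) ((W.baseChange K).geomPrimaryTorsion p)) =
                        conjH1 (κ.kerSubgroup ⊓ U) ((W.baseChange K).geomPrimaryTorsion p) γ' s)
                    (h : IsLocNil p (f₁ - 1))
                    (δ : LocNilDual (selmerOver (κ.kerSubgroup ⊓ U) ((W.baseChange K).geomPrimaryTorsion p) p 𝔭' ∅) f₁ h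
                      →ₗ[IwasawaAlgebra p]
                      LocNilDual (selmerOver (κ.kerSubgroup ⊓ U) ((W.baseChange K).geomPrimaryTorsion p) p 𝔭' ∅) f₁ h)
                    (hδ : ∀ (x : LocNilDual (selmerOver (κ.kerSubgroup ⊓ U) ((W.baseChange K).geomPrimaryTorsion p) p 𝔭' ∅) f₁ h)
                      (s t : selmerOver (κ.kerSubgroup ⊓ U) ((W.baseChange K).geomPrimaryTorsion p) p 𝔭' ∅),
                      (t : subgroupH1 (κ.kerSubgroup ⊓ U) ((W.baseChange K).geomPrimaryTorsion p)) =
                        resH1Hom (ContinuousMonoidHom.id _) φ hφH'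
                          (s : subgroupH1 (κ.kerSubgroup ⊓ U) ((W.baseChange K).geomPrimaryTorsion p)) → δ x s = x t)
                    (b : Module.Basis (Fin 2) ℤ_[p]
                      (AdjoinRoot (Polynomial.X ^ 2 - Polynomial.C ((d₀ : ℤ) : ℤ_[p]) : Polynomial ℤ_[p]))) (hb0 : b 0 = 1)
                    (hb1 : b 1 * b 1 = algebraMap ℤ_[p]
                      (AdjoinRoot (Polynomial.X ^ 2 - Polynomial.C ((d₀ : ℤ) : ℤ_[p]) : Polynomial ℤ_[p])) ((d₀ : ℤ) : ℤ_[p]))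
                    (ι : AdjoinRoot (Polynomial.X ^ 2 - Polynomial.C ((d₀ : ℤ) : ℤ_[p]) : Polynomial ℤ_[p]) →+* 𝓞_ℂ_[p])
                    (_ : ι.comp (algebraMap ℤ_[p] _) = R1.toCpInt p),
                    ∃ m : ℕ, ∀ x ∈ (charIdeal (PowerSeries
                        (AdjoinRoot (Polynomial.X ^ 2 - Polynomial.C ((d₀ : ℤ) : ℤ_[p]) : Polynomial ℤ_[p])))
                        (WithQuadratic (LocNilDual (selmerOver (κ.kerSubgroup ⊓ U) ((W.baseChange K).geomPrimaryTorsion p)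
                          p 𝔭' ∅) f₁ h) b hb0 hb1 δ
                          (delta_sq (W.baseChange K) κ 𝔭' ∅ U φ hφH' hφU hφU' d₀ hφ2 f₁ h δ hδ))).map (PowerSeries.map ι),
                      (PowerSeries.C ((p : ℕ) : 𝓞_ℂ_[p]) : PowerSeries 𝓞_ℂ_[p]) ^ m * x ∈ Ideal.span {G}

/-- V4K (odd `p`) ⟹ V4K@3 (this line's registered research stub). -/
theorem katzLineDivisibilityAtThree_of_odd (h : KatzLineDivisibilityOdd) : KatzLineDivisibilityAtThree :=
  fun W _ _ p _ _ K _ _ hCM hp ↦ h W p K hCM (by omega)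

/-- V4K (odd `p`) ⟹ BED's registered `stub_V4K` of crux 21341 (text VERBATIM = `Lines/hsieh_lambda.lean` v3 l. 179–253, `5 ≤ p`). -/
theorem bedStubV4K_of_odd (h : KatzLineDivisibilityOdd) :
    ∀ (W : WeierstrassCurve ℚ) [W.IsElliptic] [W.IsGloballyMinimal] (p : ℕ) [Fact p.Prime]
      [NeZero (W.conductorNorm ℤ)] (K : Type) [Field K] [NumberField K],
      W.HasCM → 5 ≤ p → CMInert W p → ¬ Good W p →
      IsImaginaryQuadratic K → SatisfiesHeegnerHypothesis (W.conductorNorm ℤ) K →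
      4 < (NumberField.discr K).natAbs → ¬ p ∣ NumberField.classNumber K →
      ∀ (κ : ZpExtension K p), κ.IsAnticyclotomic →
        ∀ (γ : Field.absoluteGaloisGroup K) [Fact (κ.IsTopGenerator γ)]
          (𝔭 : HeightOneSpectrum (𝓞 K)), ((p : ℕ) : 𝓞 K) ∈ 𝔭.asIdeal →
          𝔭.asIdeal.ramificationIdx (𝓞 ℚ) = 1 → 𝔭.asIdeal.inertiaDeg (𝓞 ℚ) = 1 →
          ∀ (f : CuspForm (CongruenceSubgroup.Gamma0 (W.conductorNorm ℤ)) 2), IsNewformOf W f →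
            ∀ (ι' : PadicAlgCl p ≃+* ℂ),
              (∀ (w : InfinitePlace K) (k : 𝓞 K), k ∈ 𝔭.asIdeal ↔ ‖ι'.symm (w.embedding (k : K))‖ < 1) →
                  ∀ (𝔭' : HeightOneSpectrum (𝓞 K)), ((p : ℕ) : 𝓞 K) ∈ 𝔭'.asIdeal → 𝔭' ≠ 𝔭 →
                  Module.IsTorsion (IwasawaAlgebra p) (XAc (W.baseChange K) p κ 𝔭' ∅ γ) →
                  ∀ (L : Type) [Field L] [NumberField L] [Algebra K L] [IsGalois K L]
                    (Sp S T : Finset (HeightOneSpectrum (𝓞 L))) (lam : HeckeCharacter L) (ϑ : L) (CK : ℂ)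
                    (Ω : InfinitePlace L → ℂ) (ΩpK : InfinitePlace L → ℂ_[p]) (G : PowerSeries 𝓞_ℂ_[p])
                    (w₁ w₂ : InfinitePlace L) (cL cL' : ℂ),
                    w₁ ≠ w₂ → (∀ w : InfinitePlace L, w = w₁ ∨ w = w₂) →
                    (∀ (χ : HeckeCharacter K) (n : ℕ), 0 < n → (∀ v : HeightOneSpectrum (𝓞 K), χ.IsUnramifiedAt v) →
                      χ.HasInfinityType (fun _ ↦ (n : ℤ)) (fun _ ↦ -(n : ℤ)) →
                      KatzCM.HasKatzType ι' Sp (lam * χ.compRelNorm L) 1 (fun w ↦ if w = w₁ then n else n - 1)) →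
                    (∀ (χ : HeckeCharacter K) (n : ℕ), 0 < n → (∀ v : HeightOneSpectrum (𝓞 K), χ.IsUnramifiedAt v) →
                      χ.HasInfinityType (fun _ ↦ (n : ℤ)) (fun _ ↦ -(n : ℤ)) →
                      LFunction.HasEntireContinuation (heckeLFunction (lam * χ.compRelNorm L))) →
                    cL ≠ 0 → cL' ≠ 0 →
                    (∀ (χ : HeckeCharacter K) (n : ℕ), 0 < n → (∀ v : HeightOneSpectrum (𝓞 K), χ.IsUnramifiedAt v) →
                      χ.HasInfinityType (fun _ ↦ (n : ℤ)) (fun _ ↦ -(n : ℤ)) →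
                      ∀ hL : LFunction.HasEntireContinuation (heckeLFunction (lam * χ.compRelNorm L)),
                        hL.continuation 0 = cL * cL' ^ n * rankinSelbergValueHecke f χ 1) →
                    (∀ w ∈ S ∪ KatzCM.primesOver L p, ¬ lam.IsUnramifiedAt w) →
                    (∀ w ∈ Sp ∪ T, ¬ lam.IsUnramifiedAt w) →
                    CK ≠ 0 → (∀ w, Ω w ≠ 0) → (∀ w, (KatzCM.embeddingAt ι' Sp w ϑ).im ≠ 0) → (∀ w, ΩpK w ≠ 0) →
                    KatzCM.IsBaseChangeLine ι' Sp S T κ γ lam ϑ CK Ω ΩpK G →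
                  ∀ (d₀ : ℤ) (r : AlgebraicClosure K) (ψ : (W.baseChange K).geomPoints →+ (W.baseChange K).geomPoints),
                    r * r = algebraMap K (AlgebraicClosure K) (d₀ : K) →
                    r ∉ Set.range (algebraMap K (AlgebraicClosure K)) →
                    (∀ y : ZMod p, y * y ≠ PadicInt.toZMod ((d₀ : ℤ) : ℤ_[p])) →
                    (∀ σ : absoluteGaloisGroup K, σ • r = r → ∀ P : (W.baseChange K).geomPoints, σ • ψ P = ψ (σ • P)) →
                    (∀ σ : absoluteGaloisGroup K, σ • r = -r → ∀ P : (W.baseChange K).geomPoints, σ • ψ P = -ψ (σ • P)) →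
                    (∀ P, ψ (ψ P) = d₀ • P) →
                  ∀ (U : Subgroup (absoluteGaloisGroup K)) [U.Normal], (∀ σ, σ ∈ U ↔ σ • r = r) →
                  ∀ (φ : (W.baseChange K).geomPrimaryTorsion p →+ (W.baseChange K).geomPrimaryTorsion p)
                    (_ : ∀ m, ((φ m : (W.baseChange K).geomPrimaryTorsion p) : (W.baseChange K).geomPoints) = ψ m)
                    (hφH' : ∀ (x : (κ.kerSubgroup ⊓ U : Subgroup (absoluteGaloisGroup K)))
                      (m : (W.baseChange K).geomPrimaryTorsion p), φ (x • m) = x • φ m)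
                    (hφU : ∀ σ ∈ U, ∀ m : (W.baseChange K).geomPrimaryTorsion p, φ (σ • m) = σ • φ m)
                    (hφU' : ∀ σ, σ ∉ U → ∀ m : (W.baseChange K).geomPrimaryTorsion p, φ (σ • m) = -(σ • φ m))
                    (hφ2 : ∀ m, φ (φ m) = d₀ • m)
                    (γ' : absoluteGaloisGroup K) (_ : κ.IsTopGenerator γ') (_ : γ' ∈ U)
                    (f₁ : AddMonoid.End (selmerOver (κ.kerSubgroup ⊓ U) ((W.baseChange K).geomPrimaryTorsion p) p 𝔭' ∅))
                    (_hf : ∀ s, ((f₁ s : selmerOver (κ.kerSubgroup ⊓ U) ((W.baseChange K).geomPrimaryTorsion p) p 𝔭' ∅) :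
                      subgroupH1 (κ.kerSubgroup ⊓ U) ((W.baseChange K).geomPrimaryTorsion p)) =
                        conjH1 (κ.kerSubgroup ⊓ U) ((W.baseChange K).geomPrimaryTorsion p) γ' s)
                    (h : IsLocNil p (f₁ - 1))
                    (δ : LocNilDual (selmerOver (κ.kerSubgroup ⊓ U) ((W.baseChange K).geomPrimaryTorsion p) p 𝔭' ∅) f₁ h
                      →ₗ[IwasawaAlgebra p]
                      LocNilDual (selmerOver (κ.kerSubgroup ⊓ U) ((W.baseChange K).geomPrimaryTorsion p) p 𝔭' ∅) f₁ h)
                    (hδ : ∀ (x : LocNilDual (selmerOver (κ.kerSubgroup ⊓ U) ((W.baseChange K).geomPrimaryTorsion p) p 𝔭' ∅) f₁ h)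
                      (s t : selmerOver (κ.kerSubgroup ⊓ U) ((W.baseChange K).geomPrimaryTorsion p) p 𝔭' ∅),
                      (t : subgroupH1 (κ.kerSubgroup ⊓ U) ((W.baseChange K).geomPrimaryTorsion p)) =
                        resH1Hom (ContinuousMonoidHom.id _) φ hφH'
                          (s : subgroupH1 (κ.kerSubgroup ⊓ U) ((W.baseChange K).geomPrimaryTorsion p)) → δ x s = x t)
                    (b : Module.Basis (Fin 2) ℤ_[p]
                      (AdjoinRoot (Polynomial.X ^ 2 - Polynomial.C ((d₀ : ℤ) : ℤ_[p]) : Polynomial ℤ_[p]))) (hb0 : b 0 = 1)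
                    (hb1 : b 1 * b 1 = algebraMap ℤ_[p]
                      (AdjoinRoot (Polynomial.X ^ 2 - Polynomial.C ((d₀ : ℤ) : ℤ_[p]) : Polynomial ℤ_[p])) ((d₀ : ℤ) : ℤ_[p]))
                    (ι : AdjoinRoot (Polynomial.X ^ 2 - Polynomial.C ((d₀ : ℤ) : ℤ_[p]) : Polynomial ℤ_[p]) →+* 𝓞_ℂ_[p])
                    (_ : ι.comp (algebraMap ℤ_[p] _) = R1.toCpInt p),
                    ∃ m : ℕ, ∀ x ∈ (charIdeal (PowerSeries
                        (AdjoinRoot (Polynomial.X ^ 2 - Polynomial.C ((d₀ : ℤ) : ℤ_[p]) : Polynomial ℤ_[p])))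
                        (WithQuadratic (LocNilDual (selmerOver (κ.kerSubgroup ⊓ U) ((W.baseChange K).geomPrimaryTorsion p)
                          p 𝔭' ∅) f₁ h) b hb0 hb1 δ
                          (delta_sq (W.baseChange K) κ 𝔭' ∅ U φ hφH' hφU hφU' d₀ hφ2 f₁ h δ hδ))).map (PowerSeries.map ι),
                      (PowerSeries.C ((p : ℕ) : 𝓞_ℂ_[p]) : PowerSeries 𝓞_ℂ_[p]) ^ m * x ∈ Ideal.span {G} :=
  fun W _ _ p _ _ K _ _ hCM hp ↦ h W p K hCM (by omega)

/-- The registered V2@3 stub IS `TiedKatzFrameAtThree` (definitional). -/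
theorem tiedKatzFrameAtThree_of_stub : TiedKatzFrameAtThree :=
  stub_tiedKatzFrameAtThree

/-- The registered V4K@3 stub IS `KatzLineDivisibilityAtThree` (definitional). -/
theorem katzLineDivisibilityAtThree_of_stub : KatzLineDivisibilityAtThree :=
  stub_katzLineDivisibilityAtThree

/-- **♭-heart@3 from the held print (Thm A) and the two v7 stubs** — the lead's p636175
`…HeartFlatOfParts.heartFlatAtThree_of_parts` (BED's `EisensteinHeartFlatCMInertBadKPrime_of` run at `p = 3`; `[√d₀]` at `3` by p635498).
[cite: Hsieh2014, Thm. A p. 712 (Doc. Math. 19)] -/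
theorem heartFlatAtThree_of_printedInputs (hI : PrintedInputsAtThreeCM) (hV2 : TiedKatzFrameAtThree)
    (hV4K : KatzLineDivisibilityAtThree) : HeartFlatAtThree :=
  InertBadSignedBranchesInertBadAtThreeHeartFlatOfParts.heartFlatAtThree_of_parts hI.1.1.2.1 hV2 hV4K

/-- **E_K′@3 (`HeartAtThree`) from the held print and the two v7 stubs** — the lead's p635870
`…HeartOfHeartFlat.heartAtThree_of_heartFlatAtThree` ((B) is `HeartAtThree`'s own antecedent; (Irr)@3 by p635155).
[cite: Hsieh2014, Thm. B p. 712 (Doc. Math. 19)] -/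
theorem heartAtThree_of_printedInputs (hI : PrintedInputsAtThreeCM) (hV2 : TiedKatzFrameAtThree)
    (hV4K : KatzLineDivisibilityAtThree) : HeartAtThree :=
  InertBadSignedBranchesInertBadAtThreeHeartOfHeartFlat.heartAtThree_of_heartFlatAtThree
    (heartFlatAtThree_of_printedInputs hI hV2 hV4K)

/-- **v8: ♭-heart@3 from the itemised held print and V4K@3 alone** (Thm A = conjunct (B).1; V2@3 by `tiedKatzFrameAtThree_of_printedInputs`).
[cite: Hsieh2014, Thm. A p. 712 (Doc. Math. 19)] -/
theorem heartFlatAtThree_of_min (hI : PrintedInputsAtThreeMin) (hV4K : KatzLineDivisibilityAtThree) : HeartFlatAtThree :=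
  InertBadSignedBranchesInertBadAtThreeHeartFlatOfParts.heartFlatAtThree_of_parts hI.2.1.1
    (tiedKatzFrameAtThree_of_printedInputs hI) hV4K

/-- **v8: E_K′@3 (`HeartAtThree`) from the itemised held print and V4K@3 alone.** [cite: Hsieh2014, Thm. B p. 712 (Doc. Math. 19)] -/
theorem heartAtThree_of_min (hI : PrintedInputsAtThreeMin) (hV4K : KatzLineDivisibilityAtThree) : HeartAtThree :=
  InertBadSignedBranchesInertBadAtThreeHeartOfHeartFlat.heartAtThree_of_heartFlatAtThree (heartFlatAtThree_of_min hI hV4K)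

/-- v8: `stub_heartAtThree` is a THEOREM of the skeleton (from `stub_printedInputsAtThreeMin` and `stub_katzLineDivisibilityAtThree` only);
v7: from the held print + V2@3 + V4K@3; was: STUB (rank 1, v1–v6, E_K′@3 verbatim). [cite: Hsieh2014JAMS, Thm. 8.14] -/
theorem stub_heartAtThree : HeartAtThree :=
  heartAtThree_of_min stub_printedInputsAtThreeMin katzLineDivisibilityAtThree_of_stub

end HeartCut

/-! ## The composition — v8: from the ITEMISED held print (glue `…BedGlueMin`, p638913); `InertBadAtThree_bed_of_min` is the arrow form
concluding BED's copy of the crux; `InertBadAtThree_proof` (end of file) is the ONLY theorem concluding the registered decl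
`InertBadSignedBranches.InertBadAtThree` (hypothesis-free, from the two stubs) -/

/-- **v8: C⁺odd(N,3) from the itemised held print** (conjunct (C).4, the BV mean; p615210). [cite: BhargavaVarma2016, Cor. 4 (a)] -/
theorem nonNullOddIndivisibleHeegnerThree_of_min (hI : PrintedInputsAtThreeMin) : NonNullOddIndivisibleHeegnerThree :=
  InertBadSignedBranchesInertBadAtThreeNonNullOddHeegner.nonNullOddIndivisibleHeegnerThree_of_mean hI.2.2.1.2.2.2

/-- **v8: R₃ `ManinAtThree` from the itemised held print (group (D) + modularity (A).5) and the PLAIN ODD quartic statement.**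
[cite: Stevens1989, Lemmas (5.2), (5.4)] [cite: Mazur1978, Cor. 4.1] -/
theorem maninAtThree_of_min_of_plainOddQuartic (hI : PrintedInputsAtThreeMin) (hC : PlainOddNeronIntegralThreeQuartic) : ManinAtThree :=
  InertBadSignedBranchesInertBadAtThreeManinCells.maninAtThree_of_facts_of_quarticResidual hI.2.2.2.1.1 hI.2.2.2.1.2.1 hI.2.2.2.1.2.2
    hI.1.2.2.2.2.1 (maninAtThreeQuartic_of_plainOddQuartic hC)

/-- **v8: the crux from the itemised held print, the (PROVED) plain odd quartic statement and V4K@3** — glue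
`…BedGlueMin.inertBadAtThree_bed_of_minLinks` (split minimal print hypotheses) with C⁺odd(N,3), R₃ and the heart supplied by the links above.
Stated on route `BiquadraticEisensteinDescent`'s VERBATIM copy of the crux decl (definitionally equal to `InertBadSignedBranches.InertBadAtThree`,
which `InertBadAtThree_proof` below concludes BY NAME — the skeleton audit wants exactly one theorem of the file concluding the registered decl).
[cite: Hsieh2014, Thm. A p. 712 (Doc. Math. 19)] -/
theorem InertBadAtThree_bed_of_min : PrintedInputsAtThreeMin → PlainOddNeronIntegralThreeQuartic → KatzLineDivisibilityAtThree →
    BiquadraticEisensteinDescent.InertBadAtThree :=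
  fun hI hC hV4K ↦ InertBadSignedBranchesInertBadAtThreeBedGlueMin.inertBadAtThree_bed_of_minLinks
    hI.1.1 hI.1.2.1 hI.1.2.2.1 hI.1.2.2.2.1 hI.1.2.2.2.2.1 hI.1.2.2.2.2.2.1 hI.1.2.2.2.2.2.2.1 hI.1.2.2.2.2.2.2.2
    hI.2.1.1 hI.2.1.2.1 hI.2.1.2.2 hI.2.2.1.1 hI.2.2.1.2.1 hI.2.2.1.2.2.1
    (nonNullOddIndivisibleHeegnerThree_of_min hI) (maninAtThree_of_min_of_plainOddQuartic hI hC) (heartAtThree_of_min hI hV4K)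

/-! ### v7 composition through `PrintedInputsAtThreeCM` (kept for the record; hypotheses in front, sorry-free) -/

/-- **v5–v7 composition (record)**: from v7's held print `PrintedInputsAtThreeCM` ⇒ C⁺odd(N,3) and the `Iₙ*` Manin cell; the PLAIN ODD quartic
statement (with the PROVED levers p624535/p626343) ⇒ the quartic Manin cell; then the glue helper's `inertBadAtThree_bed_of_links` with the heart.
On BED's verbatim copy of the decl (v8: the `InertBadSignedBranches`-named form of this record composition is dropped so that `InertBadAtThree_proof`
is the file's only theorem concluding the registered decl). [cite: Hsieh2014, Thm. A p. 712 (Doc. Math. 19)] -/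
theorem InertBadAtThree_bed_of : PrintedInputsAtThreeCM → PlainOddNeronIntegralThreeQuartic → HeartAtThree →
    BiquadraticEisensteinDescent.InertBadAtThree :=
  fun hI hC hE ↦ InertBadSignedBranchesInertBadAtThreeBedGlue.inertBadAtThree_bed_of_links hI.1.1
    (nonNullOddIndivisibleHeegnerThree_of_printedInputs hI) (maninAtThree_of_printedInputs_of_plainOddQuartic hI hC) hE

/-- The composition from the stubs (kernel-checked modulo the `sorry`s, all inside `stub_*`; v8: itemised held print + V4K@3;
v7: held print + V2@3 + V4K@3). -/
theorem InertBadAtThree_proof : InertBadSignedBranches.InertBadAtThree :=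
  InertBadAtThree_bed_of_min stub_printedInputsAtThreeMin plainOddQuartic_of_stub katzLineDivisibilityAtThree_of_stub

end Summit.BirchSwinnertonDyer.BirchSwinnertonDyer.Cruxes.InertBadAtThree.RubinE1InertThree

end
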